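/-
Copyright (c) 2026. All rights reserved.
Released under Apache 2.0 license as described in the file LICENSE.
-/
import Literature.AlgebraicGeometry.ComplexMultiplication.HyperellipticJacobianTwentyDvdLevel
import HarnessLib

/-!
# GGL 2024 Thm. 3.0 + Lemma 14 at the levels `60 ∣ m` — the last assembly: `End⁰(J_m)` for every `m`

Layer `Literature/AlgebraicGeometry/ComplexMultiplication`, namespace `…ComplexMultiplication.HyperellipticJacobian`; the exceptional blocks `Y_{20}`
(`Mat₄(ℚ(√−5))`) and `Y_{60}` (`Mat₄(F_{60})`, `[F_{60} : ℚ] = 4`) prepended to the F25 carrier (`60 ∣ m`, `8 ∤ m`) and to the F26 carrier (`120 ∣ m`).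
THEOREMS ONLY (no definition, no named fact, no `sorry`, no instance).

## The print

A. Gallese, H. Goodson, D. Lombardo, arXiv:2405.20394 [GalleseGoodsonLombardo2024] (held `paper:arxiv-2405.20394`, p0012, p0014, p0015): THM. 3.0
«`J_m ∼ ∏_{d ∣ m, d ≠ 1,2} X_d`», (4), (5), «`X_d ∼ Y_d⁴` for `d ∈ {20, 24, 60}`», the last statement; §3.4 (`F_{20} = ℚ(√−5)`, `F_{24} = ℚ(√−6)`, `F_{60}`
of degree `4`); §3.5 LEMMA 14 with the sentence following it.  When `60 ∣ m` the divisors `d ∉ {1, 2}` of `m` are: `20`, `60` (and `24` when `8 ∣ m`)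
— the exceptional blocks `Mat₄(F_{20})`, `Mat₄(F_{60})` (`Mat₄(F_{24})`); `4, 12` (block `Mat₃(ℚ(i))`); the pairs `{d, 2d}` over the odd divisors
`d ≠ 1`; and the remaining `e` with `4 ∣ e`, `e ∉ {4, 12, 20, 24, 60}`, non-exceptional pairwise orthogonal `Y`-blocks.  Hence
`End⁰(J_m) ≅ Mat₄(F_{20}) × Mat₄(F_{60}) [× Mat₄(F_{24})] × Mat₃(ℚ(ζ_4)) × ∏_d Mat₂(ℚ(ζ_d)) × ∏_e Mat₂(ℚ(ζ_e − ζ_e⁻¹))` of dimension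
`114 [+ 32] + 4 Σ_d φ(d) + 2 Σ_e φ(e)`, and `2 dim J_m = 30 [+ 8] + 2 Σ_d φ(d) + Σ_e φ(e)` (`m = 60`: `170`, `g = 29`, F20; `m = 180`: `410`, `g = 89`;
`m = 120`: `306`, `g = 59`).

## The carriers (family form)

`8 ∤ m`: `![A₂₀, A₆₀, A₄ ⊕ A₁₂, ⨁_i (A_i ⊕ A′_i), ⨁_j C_j]` over `Fin 5` (= `vecCons A₂₀ (vecCons A₆₀ (F25 carrier))`); `120 ∣ m`:
`![A₂₀, A₆₀, A₂₄, A₄ ⊕ A₁₂, ⨁_i (A_i ⊕ A′_i), ⨁_j C_j]` over `Fin 6` (= `vecCons A₂₀ (vecCons A₆₀ (F26 carrier))`); `A₂₀`, `A₆₀`, `A₂₄` realisations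
of the lower-half types at levels `20, 60, 24`, the rest as in F25 ∕ F26 (`d_i ∣ M` odd `> 1` distinct; `4 ∣ e_j ≥ 8`, `e_j ∉ {12, 20, 24, 60}` distinct).

## What is proved

§1 the `Y_{60}` column in family form: **`orthogonal_twiceOdd_sixty`** (every `2n`, `n` odd `≥ 3`), **`orthogonal_fourDvd_sixty`** (every non-exceptional
`4 ∣ e ≥ 8`); §2 (`60 ∣ m`, `8 ∤ m`) `hom_eq_zero_blocks_sixtyDvd`, **`nonempty_endAlgebra_algEquiv_sixtyDvd`**, **`finrank_endAlgebra_sixtyDvd`**;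
§3 (`120 ∣ m`) `hom_eq_zero_blocks_hundredTwentyDvd`, **`nonempty_endAlgebra_algEquiv_hundredTwentyDvd`**, **`finrank_endAlgebra_hundredTwentyDvd`**.

## Honest column ∕ NOT here

The curve and the identification of the carriers with `J_m` (Thm. 3.0's isogeny is the INPUT reading); the closed forms of the sums.  `HC_CM` is
not touched.

## References

* [GalleseGoodsonLombardo2024] arXiv:2405.20394 — §3 Thm. 3.0, §3.4, §3.5 Lemma 14 and the sentence following it.
* [MumfordAV1970] D. Mumford — §19 Thm. 3 Cor. 1–2, p. 174.
* [Shimura1998] G. Shimura — §5.1 Prop. 3, 4, 6, §8.3 Prop. 28.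
* [MilneCM2006] J. S. Milne — Ch. I §1 Prop. 1.18 (c), §3 Prop. 3.13.

## Provenance

Cell `pub-hodgecm2` (COR-CM), KEPT Literature lane `lit-deligne-3` gen 52 (claim GGL24-SIXTY-DVD; count-neutral, own lane).
-/

noncomputable section

open CategoryTheory CategoryTheory.Limits NumberField Module

namespace Literature.AlgebraicGeometry.ComplexMultiplication

open Literature.AlgebraicGeometry.Motives
open Literature.AlgebraicGeometry.HodgeTheory (complexBetti)
open Literature.NumberTheory.ComplexMultiplication

namespace HyperellipticJacobian

open Literature.AlgebraicGeometry.Pohlmann1968 Literature.AlgebraicGeometry.Pohlmann1968.Cyclotomic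

/-! ## §0 Arithmetic -/

section Arithmetic

/-- An odd number of totient `≤ 2` is `1` or `3`. [folklore] -/
private theorem eq_one_or_three_of_odd_of_totient_le_two₆₀ {q : ℕ} (hq : Odd q) (hφ : Nat.totient q ≤ 2) : q = 1 ∨ q = 3 := by
  by_cases hq1 : q = 1
  · exact Or.inl hq1
  right
  have hpp : q.minFac.Prime := Nat.minFac_prime hq1
  obtain ⟨r, hr⟩ := Nat.minFac_dvd q
  have hr0 : 0 < r := by
    refine Nat.pos_of_ne_zero ?_
    rintro rfl
    rw [mul_zero] at hr
    have := hq.pos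
    omega
  have hrodd : Odd r := hq.of_dvd_nat ⟨q.minFac, hr.trans (mul_comm _ _)⟩
  have hpodd : Odd q.minFac := hq.of_dvd_nat ⟨r, hr⟩
  have hp3 : 3 ≤ q.minFac := by
    have h2 := hpp.two_le
    rcases Nat.eq_or_lt_of_le h2 with h | h
    · rw [← h] at hpodd
      exact absurd hpodd (by decide)
    · omega
  have key : (q.minFac - 1) * Nat.totient r ≤ 2 := by
    calc (q.minFac - 1) * Nat.totient r = Nat.totient q.minFac * Nat.totient r := by rw [Nat.totient_prime hpp]
      _ ≤ Nat.totient (q.minFac * r) := Nat.totient_super_multiplicative _ _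
      _ = Nat.totient q := by rw [← hr]
      _ ≤ 2 := hφ
  have hφr : 0 < Nat.totient r := Nat.totient_pos.2 hr0
  have hp3' : q.minFac = 3 := by
    have : (q.minFac - 1) * 1 ≤ 2 := le_trans (Nat.mul_le_mul_left _ hφr) key
    omega
  have hφr1 : Nat.totient r ≤ 1 := by
    rw [hp3'] at key
    omega
  have hr2 : r ∣ 2 := Nat.dvd_two_of_totient_le_one hr0 hφr1
  have hr1 : r = 1 := by
    rcases (Nat.dvd_prime Nat.prime_two).1 hr2 with h | h
    · exact h
    · rw [h] at hrodd
      exact absurd hrodd (by decide)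
  rw [hr, hp3', hr1]

/-- An odd number of totient `4` is `5`. [folklore] -/
private theorem eq_five_of_odd_of_totient_eq_four {q : ℕ} (hq : Odd q) (hφ : Nat.totient q = 4) : q = 5 := by
  have hq1 : q ≠ 1 := by
    rintro rfl
    simp at hφ
  have hpp : q.minFac.Prime := Nat.minFac_prime hq1
  obtain ⟨r, hr⟩ := Nat.minFac_dvd q
  have hr0 : 0 < r := by
    refine Nat.pos_of_ne_zero ?_
    rintro rfl
    rw [mul_zero] at hr
    have := hq.pos
    omega
  have hrodd : Odd r := hq.of_dvd_nat ⟨q.minFac, hr.trans (mul_comm _ _)⟩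
  have hpodd : Odd q.minFac := hq.of_dvd_nat ⟨r, hr⟩
  have hp3 : 3 ≤ q.minFac := by
    have h2 := hpp.two_le
    rcases Nat.eq_or_lt_of_le h2 with h | h
    · rw [← h] at hpodd
      exact absurd hpodd (by decide)
    · omega
  have hφr : 0 < Nat.totient r := Nat.totient_pos.2 hr0
  have key : (q.minFac - 1) * Nat.totient r ≤ 4 := by
    calc (q.minFac - 1) * Nat.totient r = Nat.totient q.minFac * Nat.totient r := by rw [Nat.totient_prime hpp]
      _ ≤ Nat.totient (q.minFac * r) := Nat.totient_super_multiplicative _ _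
      _ = Nat.totient q := by rw [← hr]
      _ ≤ 4 := hφ.le
  -- `p = q.minFac ∈ {3, 5}` (`p = 4` is not prime)
  have hp5 : q.minFac ≤ 5 := by
    have : (q.minFac - 1) * 1 ≤ 4 := le_trans (Nat.mul_le_mul_left _ hφr) key
    omega
  have hp4 : q.minFac ≠ 4 := fun h => by
    rw [h] at hpodd
    exact absurd hpodd (by decide)
  by_cases hp : q.minFac = 5
  · -- `φ(r) ≤ 1`, `r` odd ⟹ `r = 1`
    have hφr1 : Nat.totient r ≤ 1 := by
      rw [hp] at key
      omega
    have hr2 : r ∣ 2 := Nat.dvd_two_of_totient_le_one hr0 hφr1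
    have hr1 : r = 1 := by
      rcases (Nat.dvd_prime Nat.prime_two).1 hr2 with h | h
      · exact h
      · rw [h] at hrodd
        exact absurd hrodd (by decide)
    rw [hr, hp, hr1]
  · -- `p = 3`: impossible
    exfalso
    have hp3' : q.minFac = 3 := by omega
    by_cases h3r : 3 ∣ r
    · -- `9 ∣ q`: `φ(q) ≥ φ(9) φ(r/3) ≥ 6`
      obtain ⟨s, rfl⟩ := h3r
      have hs0 : 0 < s := by omega
      have h9 : Nat.totient 9 * Nat.totient s ≤ Nat.totient q := by
        have hq9 : q = 9 * s := by rw [hr, hp3']; ring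
        rw [hq9]
        exact Nat.totient_super_multiplicative 9 s
      rw [hφ, show Nat.totient 9 = 6 by decide +kernel] at h9
      have := Nat.totient_pos.2 hs0
      omega
    · -- `q = 3 r`, `3 ∤ r`: `φ(q) = 2 φ(r) = 4`, `φ(r) = 2`, `r` odd ⟹ `r = 3`, contradiction
      have hcop : Nat.Coprime 3 r := (Nat.Prime.coprime_iff_not_dvd Nat.prime_three).2 h3r
      have hq3 : q = 3 * r := by rw [hr, hp3']
      have h2 : Nat.totient r = 2 := by
        have := hφ
        rw [hq3, Nat.totient_mul hcop, show Nat.totient 3 = 2 by decide +kernel] at this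
        omega
      rcases eq_one_or_three_of_odd_of_totient_le_two₆₀ hrodd h2.le with h | h
      · rw [h] at h2
        simp at h2
      · exact h3r (by rw [h])

/-- `φ(2n) ≠ 4` for odd `n ≥ 3` not divisible by `5`. [folklore] -/
private theorem totient_two_mul_ne_four_of_odd {n : ℕ} (hn : Odd n) (hn5 : ¬ 5 ∣ n) : Nat.totient (2 * n) ≠ 4 := by
  intro h
  rw [Nat.totient_mul (Nat.coprime_two_left.2 hn), Nat.totient_two, one_mul] at h
  exact hn5 (by rw [eq_five_of_odd_of_totient_eq_four hn h])

/-- `φ(e) ≠ 8` for `4 ∣ e`, `8 ∤ e`, `e ≠ 20` (`e = 4n`, `n` odd, `φ(e) = 2φ(n)`, `φ(n) = 4 ⟹ n = 5`). [folklore] -/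
private theorem totient_ne_eight_of_not_eight_dvd {e : ℕ} (h4 : 4 ∣ e) (h8n : ¬ 8 ∣ e) (h20 : e ≠ 20) : Nat.totient e ≠ 8 := by
  obtain ⟨n, rfl⟩ := h4
  have hn : Odd n := by
    rcases Nat.even_or_odd n with h | h
    · obtain ⟨k, rfl⟩ := h
      exact absurd ⟨k, by ring⟩ h8n
    · exact h
  intro h
  have hcop : Nat.Coprime 4 n := by
    have h2 : Nat.Coprime 2 n := Nat.coprime_two_left.2 hn
    simpa using h2.pow_left 2
  rw [Nat.totient_mul hcop, show Nat.totient 4 = 2 by decide +kernel] at h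
  have h5 := eq_five_of_odd_of_totient_eq_four hn (by omega)
  subst h5
  exact h20 rfl

/-- An odd divisor `n ≥ 3` of `60` not divisible by `5` is `3`. [folklore] -/
private theorem eq_three_of_dvd_sixty {n : ℕ} (hn : Odd n) (h3 : 3 ≤ n) (hn5 : ¬ 5 ∣ n) (h60 : n ∣ 60) : n = 3 := by
  have hle : n ≤ 60 := Nat.le_of_dvd (by norm_num) h60
  interval_cases n <;>
    first
    | rfl
    | exact absurd h60 (by decide)
    | exact absurd hn (by decide)
    | exact absurd hn5 (by decide)

end Arithmetic

/-! ## §1 The `Y_{60}` column in family form -/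

section SixtyColumn

variable {d : ℕ} [NeZero d] {K : Type} [Field K] [NumberField K] [IsCyclotomicExtension {d} ℚ K] {Φ : CMType K}
  {A : AbelianVariety ℂ} {ι : 𝓞 K →+* End A} {θ : K →+* Module.End ℂ (complexBetti A.X 1)}
  {n : ℕ} [NeZero (2 * n)] {L : Type} [Field L] [NumberField L] [IsCyclotomicExtension {2 * n} ℚ L] {Ψ : CMType L}
  {B : AbelianVariety ℂ} {ιB : 𝓞 L →+* End B} {θB : L →+* Module.End ℂ (complexBetti B.X 1)}
  {K' : Type} [Field K'] [NumberField K'] [IsCyclotomicExtension {60} ℚ K'] {Φ' : CMType K'}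
  {A' : AbelianVariety ℂ} {ι' : 𝓞 K' →+* End A'} {θ' : K' →+* Module.End ℂ (complexBetti A'.X 1)}

/-- **`X_{2n} ⟂ Y_{60}` for EVERY odd `n ≥ 3`** (`5 ∣ n`: a primitive fifth root of unity in `K*`, F19; `n ∤ 60`: a primitive `n`-th root of unity,
F20; `n = 3`: reflex degrees `φ(6) = 2 ≠ 4`, F17).
[cite: GalleseGoodsonLombardo2024, §3 Thm. 3.0 (4), (last statement) and §3.4 (`F_{60}`)] [cite: MilneCM2006, Ch. I §1 Prop. 1.18 (c), §3 Prop. 3.13] -/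
theorem orthogonal_twiceOdd_sixty (hn : Odd n) (h3n : 3 ≤ n)
    (hΨ : ∀ σ : L →+* ℂ, σ ∈ Ψ.1 ↔ 2 * (expOf (2 * n) L σ).val < 2 * n) (hB : IsCMTypeRealisation Ψ B ιB θB)
    (hΦ' : ∀ σ : K' →+* ℂ, σ ∈ Φ'.1 ↔ 2 * (expOf 60 K' σ).val < 60) (hA' : IsCMTypeRealisation Φ' A' ι' θ') :
    (∀ u : B ⟶ A', u = 0) ∧ (∀ v : A' ⟶ B, v = 0) ∧
      ¬ AbelianVariety.IsIsogenous B A' ∧ ¬ AbelianVariety.IsIsogenous A' B := by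
  haveI : NeZero (60 : ℕ) := ⟨by norm_num⟩
  by_cases h5 : 5 ∣ n
  · exact orthogonal_twiceOdd_sixty_of_five_dvd hn h3n h5 hΨ hB hΦ' hA'
  by_cases h60 : n ∣ 60
  · have h3 : n = 3 := eq_three_of_dvd_sixty hn h3n h5 h60
    refine orthogonal_twiceOdd_sixty_of_totient_ne_four hn h3n ?_ hΨ hB hΦ' hA'
    rw [h3]
    decide +kernel
  · exact orthogonal_twiceOdd_of_not_dvd 60 hn h3n h60 hΨ hB hA'

/-- **`Y_e ⟂ Y_{60}` for EVERY non-exceptional `4 ∣ e ≥ 8`** (`8 ∣ e`: F23 `orthogonal_sixty_fourDvd_of_eight_dvd`; `8 ∤ e`: reflex degrees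
`φ(e)/2 ≠ 4`, F20, as `φ(e) = 8` with `e ≡ 4 (mod 8)` forces `e = 20`): `Hom = 0` both ways.
[cite: GalleseGoodsonLombardo2024, §3 Thm. 3.0 (last statement) and §3.4 (`F_{60}`)] [cite: MilneCM2006, Ch. I §1 Prop. 1.18 (c), §3 Prop. 3.13] -/
theorem orthogonal_fourDvd_sixty (h4 : 4 ∣ d) (h8 : 8 ≤ d) (h20 : d ≠ 20) (h24 : d ≠ 24) (h60 : d ≠ 60)
    (hΦ : ∀ σ : K →+* ℂ, σ ∈ Φ.1 ↔ 2 * (expOf d K σ).val < d) (hA : IsCMTypeRealisation Φ A ι θ)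
    (hΦ' : ∀ σ : K' →+* ℂ, σ ∈ Φ'.1 ↔ 2 * (expOf 60 K' σ).val < 60) (hA' : IsCMTypeRealisation Φ' A' ι' θ') :
    (∀ u : A ⟶ A', u = 0) ∧ (∀ v : A' ⟶ A, v = 0) := by
  by_cases h8d : 8 ∣ d
  · have h := orthogonal_sixty_fourDvd_of_eight_dvd hA' h8d h24 hΦ hA
    exact ⟨h.1, h.2.1⟩
  · have h := orthogonal_fourDvd_sixty_of_totient_ne_eight h4 h8 h20 h24 h60 (totient_ne_eight_of_not_eight_dvd h4 h8d h20) hΦ hA hΦ' hA'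
    exact ⟨h.1, h.2.1⟩

end SixtyColumn

/-! ## §2 The levels `60 ∣ m`, `8 ∤ m` -/

section SixtyDvd

variable {K₂₀ : Type} [Field K₂₀] [NumberField K₂₀] [IsCyclotomicExtension {20} ℚ K₂₀] {Φ₂₀ : CMType K₂₀}
  {A₂₀ : AbelianVariety ℂ} {ι₂₀ : 𝓞 K₂₀ →+* End A₂₀} {θ₂₀ : K₂₀ →+* Module.End ℂ (complexBetti A₂₀.X 1)}
  {K₆₀ : Type} [Field K₆₀] [NumberField K₆₀] [IsCyclotomicExtension {60} ℚ K₆₀] {Φ₆₀ : CMType K₆₀}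
  {A₆₀ : AbelianVariety ℂ} {ι₆₀ : 𝓞 K₆₀ →+* End A₆₀} {θ₆₀ : K₆₀ →+* Module.End ℂ (complexBetti A₆₀.X 1)}
  {K₂₄ : Type} [Field K₂₄] [NumberField K₂₄] [IsCyclotomicExtension {24} ℚ K₂₄] {Φ₂₄ : CMType K₂₄}
  {A₂₄ : AbelianVariety ℂ} {ι₂₄ : 𝓞 K₂₄ →+* End A₂₄} {θ₂₄ : K₂₄ →+* Module.End ℂ (complexBetti A₂₄.X 1)}
  {K₄ : Type} [Field K₄] [NumberField K₄] [IsCyclotomicExtension {4} ℚ K₄] {Φ₄ : CMType K₄}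
  {A₄ : AbelianVariety ℂ} {ι₄ : 𝓞 K₄ →+* End A₄} {θ₄ : K₄ →+* Module.End ℂ (complexBetti A₄.X 1)}
  {K₁₂ : Type} [Field K₁₂] [NumberField K₁₂] [IsCyclotomicExtension {12} ℚ K₁₂] {Φ₁₂ : CMType K₁₂}
  {A₁₂ : AbelianVariety ℂ} {ι₁₂ : 𝓞 K₁₂ →+* End A₁₂} {θ₁₂ : K₁₂ →+* Module.End ℂ (complexBetti A₁₂.X 1)}
  {k₁ : ℕ} {lev₁ : Fin (k₁ + 1) → ℕ} [∀ i, NeZero (lev₁ i)] [∀ i, NeZero (2 * lev₁ i)]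
  {K : Fin (k₁ + 1) → Type} [∀ i, Field (K i)] [∀ i, NumberField (K i)] [∀ i, IsCyclotomicExtension {lev₁ i} ℚ (K i)]
  {L : Fin (k₁ + 1) → Type} [∀ i, Field (L i)] [∀ i, NumberField (L i)] [∀ i, IsCyclotomicExtension {2 * lev₁ i} ℚ (L i)]
  {Φ : ∀ i, CMType (K i)} {ΦL : ∀ i, CMType (L i)}
  {A A' : Fin (k₁ + 1) → AbelianVariety ℂ} {ι : ∀ i, 𝓞 (K i) →+* End (A i)}
  {θ : ∀ i, K i →+* Module.End ℂ (complexBetti (A i).X 1)} {ι' : ∀ i, 𝓞 (L i) →+* End (A' i)}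
  {θ' : ∀ i, L i →+* Module.End ℂ (complexBetti (A' i).X 1)} {M : ℕ}
  {k₂ : ℕ} {lev₂ : Fin k₂ → ℕ} [∀ j, NeZero (lev₂ j)] {F : Fin k₂ → Type} [∀ j, Field (F j)] [∀ j, NumberField (F j)]
  [∀ j, IsCyclotomicExtension {lev₂ j} ℚ (F j)] {Ψ : ∀ j, CMType (F j)} {C : Fin k₂ → AbelianVariety ℂ}
  {ιC : ∀ j, 𝓞 (F j) →+* End (C j)} {θC : ∀ j, F j →+* Module.End ℂ (complexBetti (C j).X 1)}

omit [∀ i, NeZero (lev₁ i)] [∀ i, NeZero (2 * lev₁ i)] in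
/-- Divisors `d_i > 1` of an odd `M` are odd and at least `3`. [folklore] -/
private theorem odd_and_three_le₆₀ (hodd : Odd M) (hdvd : ∀ i, lev₁ i ∣ M) (h1 : ∀ i, 1 < lev₁ i) (i : Fin (k₁ + 1)) :
    Odd (lev₁ i) ∧ 3 ≤ lev₁ i := by
  have ho : Odd (lev₁ i) := hodd.of_dvd_nat (hdvd i)
  refine ⟨ho, ?_⟩
  obtain ⟨r, hr⟩ := ho
  have := h1 i
  omega

/-- The `Y_{60}` column against the three F25 blocks `X_4 ⊕ X_{12}`, `⨁ (X_d ⊕ X_{2d})`, `⨁ X_e`. [cite: GalleseGoodsonLombardo2024, §3 Thm. 3.0 (last statement)]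
[cite: MilneCM2006, Ch. I §3 Prop. 3.13] -/
theorem hom_eq_zero_sixty_blocks (hodd : Odd M) (hdvd : ∀ i, lev₁ i ∣ M) (h1 : ∀ i, 1 < lev₁ i)
    (hΦ : ∀ i (σ : K i →+* ℂ), σ ∈ (Φ i).1 ↔ 2 * (expOf (lev₁ i) (K i) σ).val < lev₁ i)
    (hΦL : ∀ i (σ : L i →+* ℂ), σ ∈ (ΦL i).1 ↔ 2 * (expOf (2 * lev₁ i) (L i) σ).val < 2 * lev₁ i)
    (hA : ∀ i, IsCMTypeRealisation (Φ i) (A i) (ι i) (θ i)) (hA' : ∀ i, IsCMTypeRealisation (ΦL i) (A' i) (ι' i) (θ' i))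
    (hA₄ : IsCMTypeRealisation Φ₄ A₄ ι₄ θ₄)
    (hΦ₁₂ : ∀ σ : K₁₂ →+* ℂ, σ ∈ Φ₁₂.1 ↔ 2 * (expOf 12 K₁₂ σ).val < 12) (hA₁₂ : IsCMTypeRealisation Φ₁₂ A₁₂ ι₁₂ θ₁₂)
    (hΦ₆₀ : ∀ σ : K₆₀ →+* ℂ, σ ∈ Φ₆₀.1 ↔ 2 * (expOf 60 K₆₀ σ).val < 60) (hA₆₀ : IsCMTypeRealisation Φ₆₀ A₆₀ ι₆₀ θ₆₀)
    (h4 : ∀ j, 4 ∣ lev₂ j) (h8 : ∀ j, 8 ≤ lev₂ j) (h20 : ∀ j, lev₂ j ≠ 20) (h24 : ∀ j, lev₂ j ≠ 24) (h60 : ∀ j, lev₂ j ≠ 60)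
    (hΨ : ∀ j (σ : F j →+* ℂ), σ ∈ (Ψ j).1 ↔ 2 * (expOf (lev₂ j) (F j) σ).val < lev₂ j)
    (hC : ∀ j, IsCMTypeRealisation (Ψ j) (C j) (ιC j) (θC j)) :
    ∀ l, (∀ u : A₆₀ ⟶ (![⨁ fun l : Fin 2 => (![A₄, A₁₂] : Fin 2 → AbelianVariety ℂ) l,
        ⨁ fun i => ⨁ fun l : Fin 2 => (![A i, A' i] : Fin 2 → AbelianVariety ℂ) l, ⨁ C] : Fin 3 → AbelianVariety ℂ) l, u = 0) ∧
      (∀ v : (![⨁ fun l : Fin 2 => (![A₄, A₁₂] : Fin 2 → AbelianVariety ℂ) l,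
        ⨁ fun i => ⨁ fun l : Fin 2 => (![A i, A' i] : Fin 2 → AbelianVariety ℂ) l, ⨁ C] : Fin 3 → AbelianVariety ℂ) l ⟶ A₆₀, v = 0) := by
  classical
  haveI : NeZero (12 : ℕ) := ⟨by norm_num⟩
  have ho : ∀ i, Odd (lev₁ i) ∧ 3 ≤ lev₁ i := odd_and_three_le₆₀ hodd hdvd h1
  have o4 := orthogonal_four_sixty hA₄ hΦ₆₀ hA₆₀
  have o12 := orthogonal_fourDvd_sixty_of_totient_ne_eight (d := 12) (by norm_num) (by norm_num) (by norm_num) (by norm_num) (by norm_num)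
    (by decide +kernel) hΦ₁₂ hA₁₂ hΦ₆₀ hA₆₀
  have oA : ∀ i, (∀ u : A i ⟶ A₆₀, u = 0) ∧ (∀ v : A₆₀ ⟶ A i, v = 0) := fun i =>
    let h := orthogonal_odd_sixty' (ho i).1 (ho i).2 (hΦ i) (hA i) hΦ₆₀ hA₆₀
    ⟨h.1, h.2.1⟩
  have oA' : ∀ i, (∀ u : A' i ⟶ A₆₀, u = 0) ∧ (∀ v : A₆₀ ⟶ A' i, v = 0) := fun i =>
    let h := orthogonal_twiceOdd_sixty (ho i).1 (ho i).2 (hΦL i) (hA' i) hΦ₆₀ hA₆₀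
    ⟨h.1, h.2.1⟩
  have oC : ∀ j, (∀ u : C j ⟶ A₆₀, u = 0) ∧ (∀ v : A₆₀ ⟶ C j, v = 0) := fun j =>
    orthogonal_fourDvd_sixty (h4 j) (h8 j) (h20 j) (h24 j) (h60 j) (hΨ j) (hC j) hΦ₆₀ hA₆₀
  have b0 : (∀ u : A₆₀ ⟶ ⨁ fun l : Fin 2 => (![A₄, A₁₂] : Fin 2 → AbelianVariety ℂ) l, u = 0) ∧
      (∀ v : (⨁ fun l : Fin 2 => (![A₄, A₁₂] : Fin 2 → AbelianVariety ℂ) l) ⟶ A₆₀, v = 0) :=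
    ⟨fun u => hom_to_pair_eq_zero o4.2.1 o12.2.1 u, fun v => hom_from_pair_eq_zero o4.1 o12.1 v⟩
  have b1 : (∀ u : A₆₀ ⟶ ⨁ fun i => ⨁ fun l : Fin 2 => (![A i, A' i] : Fin 2 → AbelianVariety ℂ) l, u = 0) ∧
      (∀ v : (⨁ fun i => ⨁ fun l : Fin 2 => (![A i, A' i] : Fin 2 → AbelianVariety ℂ) l) ⟶ A₆₀, v = 0) :=
    ⟨fun u => hom_to_biproduct_eq_zero (fun i w => hom_to_pair_eq_zero (oA i).2 (oA' i).2 w) u,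
      fun v => hom_from_biproduct_eq_zero (fun i w => hom_from_pair_eq_zero (oA i).1 (oA' i).1 w) v⟩
  have b2 : (∀ u : A₆₀ ⟶ ⨁ C, u = 0) ∧ (∀ v : (⨁ C) ⟶ A₆₀, v = 0) :=
    ⟨fun u => hom_to_biproduct_eq_zero (fun j w => (oC j).2 w) u, fun v => hom_from_biproduct_eq_zero (fun j w => (oC j).1 w) v⟩
  exact Fin.cons b0 (Fin.cons b1 (Fin.cons b2 finZeroElim))

/-- The `Y_{20}` column against the F25 blocks and `Y_{60}`: `Y_{20} ⟂ Y_{60}` (F20), `X_{12}` (F16), the rest as in F27.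
[cite: GalleseGoodsonLombardo2024, §3 Thm. 3.0 (last statement)] [cite: MilneCM2006, Ch. I §3 Prop. 3.13] -/
theorem hom_eq_zero_twenty_blocks (hodd : Odd M) (hdvd : ∀ i, lev₁ i ∣ M) (h1 : ∀ i, 1 < lev₁ i)
    (hΦ : ∀ i (σ : K i →+* ℂ), σ ∈ (Φ i).1 ↔ 2 * (expOf (lev₁ i) (K i) σ).val < lev₁ i)
    (hΦL : ∀ i (σ : L i →+* ℂ), σ ∈ (ΦL i).1 ↔ 2 * (expOf (2 * lev₁ i) (L i) σ).val < 2 * lev₁ i)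
    (hA : ∀ i, IsCMTypeRealisation (Φ i) (A i) (ι i) (θ i)) (hA' : ∀ i, IsCMTypeRealisation (ΦL i) (A' i) (ι' i) (θ' i))
    (hA₄ : IsCMTypeRealisation Φ₄ A₄ ι₄ θ₄)
    (hΦ₁₂ : ∀ σ : K₁₂ →+* ℂ, σ ∈ Φ₁₂.1 ↔ 2 * (expOf 12 K₁₂ σ).val < 12) (hA₁₂ : IsCMTypeRealisation Φ₁₂ A₁₂ ι₁₂ θ₁₂)
    (hΦ₂₀ : ∀ σ : K₂₀ →+* ℂ, σ ∈ Φ₂₀.1 ↔ 2 * (expOf 20 K₂₀ σ).val < 20) (hA₂₀ : IsCMTypeRealisation Φ₂₀ A₂₀ ι₂₀ θ₂₀)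
    (hΦ₆₀ : ∀ σ : K₆₀ →+* ℂ, σ ∈ Φ₆₀.1 ↔ 2 * (expOf 60 K₆₀ σ).val < 60) (hA₆₀ : IsCMTypeRealisation Φ₆₀ A₆₀ ι₆₀ θ₆₀)
    (h4 : ∀ j, 4 ∣ lev₂ j) (h8 : ∀ j, 8 ≤ lev₂ j) (h20 : ∀ j, lev₂ j ≠ 20) (h24 : ∀ j, lev₂ j ≠ 24) (h60 : ∀ j, lev₂ j ≠ 60)
    (hΨ : ∀ j (σ : F j →+* ℂ), σ ∈ (Ψ j).1 ↔ 2 * (expOf (lev₂ j) (F j) σ).val < lev₂ j)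
    (hC : ∀ j, IsCMTypeRealisation (Ψ j) (C j) (ιC j) (θC j)) :
    ∀ l, (∀ u : A₂₀ ⟶ (![A₆₀, ⨁ fun l : Fin 2 => (![A₄, A₁₂] : Fin 2 → AbelianVariety ℂ) l,
        ⨁ fun i => ⨁ fun l : Fin 2 => (![A i, A' i] : Fin 2 → AbelianVariety ℂ) l, ⨁ C] : Fin 4 → AbelianVariety ℂ) l, u = 0) ∧
      (∀ v : (![A₆₀, ⨁ fun l : Fin 2 => (![A₄, A₁₂] : Fin 2 → AbelianVariety ℂ) l,
        ⨁ fun i => ⨁ fun l : Fin 2 => (![A i, A' i] : Fin 2 → AbelianVariety ℂ) l, ⨁ C] : Fin 4 → AbelianVariety ℂ) l ⟶ A₂₀, v = 0) := by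
  classical
  haveI : NeZero (12 : ℕ) := ⟨by norm_num⟩
  have ho : ∀ i, Odd (lev₁ i) ∧ 3 ≤ lev₁ i := odd_and_three_le₆₀ hodd hdvd h1
  have o60 := orthogonal_twenty_sixty hΦ₂₀ hA₂₀ hΦ₆₀ hA₆₀
  have o4 := orthogonal_four_twenty hA₄ hΦ₂₀ hA₂₀
  have o12 := orthogonal_fourDvd_twenty (d := 12) (by norm_num) (by norm_num) (by norm_num) (by norm_num) (by norm_num) hΦ₁₂ hA₁₂ hΦ₂₀ hA₂₀
  have oA : ∀ i, (∀ u : A i ⟶ A₂₀, u = 0) ∧ (∀ v : A₂₀ ⟶ A i, v = 0) := fun i =>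
    let h := orthogonal_odd_twenty (ho i).1 (ho i).2 (hΦ i) (hA i) hΦ₂₀ hA₂₀
    ⟨h.1, h.2.1⟩
  have oA' : ∀ i, (∀ u : A' i ⟶ A₂₀, u = 0) ∧ (∀ v : A₂₀ ⟶ A' i, v = 0) := fun i =>
    let h := orthogonal_twiceOdd_twenty (ho i).1 (ho i).2 (hΦL i) (hA' i) hΦ₂₀ hA₂₀
    ⟨h.1, h.2.1⟩
  have oC : ∀ j, (∀ u : C j ⟶ A₂₀, u = 0) ∧ (∀ v : A₂₀ ⟶ C j, v = 0) := fun j =>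
    orthogonal_fourDvd_twenty (h4 j) (h8 j) (h20 j) (h24 j) (h60 j) (hΨ j) (hC j) hΦ₂₀ hA₂₀
  have b60 : (∀ u : A₂₀ ⟶ A₆₀, u = 0) ∧ (∀ v : A₆₀ ⟶ A₂₀, v = 0) := ⟨o60.1, o60.2.1⟩
  have b0 : (∀ u : A₂₀ ⟶ ⨁ fun l : Fin 2 => (![A₄, A₁₂] : Fin 2 → AbelianVariety ℂ) l, u = 0) ∧
      (∀ v : (⨁ fun l : Fin 2 => (![A₄, A₁₂] : Fin 2 → AbelianVariety ℂ) l) ⟶ A₂₀, v = 0) :=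
    ⟨fun u => hom_to_pair_eq_zero o4.2.1 o12.2 u, fun v => hom_from_pair_eq_zero o4.1 o12.1 v⟩
  have b1 : (∀ u : A₂₀ ⟶ ⨁ fun i => ⨁ fun l : Fin 2 => (![A i, A' i] : Fin 2 → AbelianVariety ℂ) l, u = 0) ∧
      (∀ v : (⨁ fun i => ⨁ fun l : Fin 2 => (![A i, A' i] : Fin 2 → AbelianVariety ℂ) l) ⟶ A₂₀, v = 0) :=
    ⟨fun u => hom_to_biproduct_eq_zero (fun i w => hom_to_pair_eq_zero (oA i).2 (oA' i).2 w) u,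
      fun v => hom_from_biproduct_eq_zero (fun i w => hom_from_pair_eq_zero (oA i).1 (oA' i).1 w) v⟩
  have b2 : (∀ u : A₂₀ ⟶ ⨁ C, u = 0) ∧ (∀ v : (⨁ C) ⟶ A₂₀, v = 0) :=
    ⟨fun u => hom_to_biproduct_eq_zero (fun j w => (oC j).2 w) u, fun v => hom_from_biproduct_eq_zero (fun j w => (oC j).1 w) v⟩
  exact Fin.cons b60 (Fin.cons b0 (Fin.cons b1 (Fin.cons b2 finZeroElim)))

/-- **The five parts `Y_{20}`-block, `Y_{60}`-block, `X_4 ⊕ X_{12}`, `⨁_i (X_{d_i} ⊕ X_{2d_i})`, `⨁_j X_{e_j}` of `J_m` (`60 ∣ m`, `8 ∤ m`) are pairwise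
orthogonal.** [cite: GalleseGoodsonLombardo2024, §3 Thm. 3.0 (last statement)] [cite: MilneCM2006, Ch. I §3 Prop. 3.13] -/
theorem hom_eq_zero_blocks_sixtyDvd (hodd : Odd M) (hdvd : ∀ i, lev₁ i ∣ M) (h1 : ∀ i, 1 < lev₁ i)
    (hΦ : ∀ i (σ : K i →+* ℂ), σ ∈ (Φ i).1 ↔ 2 * (expOf (lev₁ i) (K i) σ).val < lev₁ i)
    (hΦL : ∀ i (σ : L i →+* ℂ), σ ∈ (ΦL i).1 ↔ 2 * (expOf (2 * lev₁ i) (L i) σ).val < 2 * lev₁ i)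
    (hA : ∀ i, IsCMTypeRealisation (Φ i) (A i) (ι i) (θ i)) (hA' : ∀ i, IsCMTypeRealisation (ΦL i) (A' i) (ι' i) (θ' i))
    (hA₄ : IsCMTypeRealisation Φ₄ A₄ ι₄ θ₄)
    (hΦ₁₂ : ∀ σ : K₁₂ →+* ℂ, σ ∈ Φ₁₂.1 ↔ 2 * (expOf 12 K₁₂ σ).val < 12) (hA₁₂ : IsCMTypeRealisation Φ₁₂ A₁₂ ι₁₂ θ₁₂)
    (hΦ₂₀ : ∀ σ : K₂₀ →+* ℂ, σ ∈ Φ₂₀.1 ↔ 2 * (expOf 20 K₂₀ σ).val < 20) (hA₂₀ : IsCMTypeRealisation Φ₂₀ A₂₀ ι₂₀ θ₂₀)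
    (hΦ₆₀ : ∀ σ : K₆₀ →+* ℂ, σ ∈ Φ₆₀.1 ↔ 2 * (expOf 60 K₆₀ σ).val < 60) (hA₆₀ : IsCMTypeRealisation Φ₆₀ A₆₀ ι₆₀ θ₆₀)
    (h4 : ∀ j, 4 ∣ lev₂ j) (h8 : ∀ j, 8 ≤ lev₂ j) (h12 : ∀ j, lev₂ j ≠ 12) (h20 : ∀ j, lev₂ j ≠ 20) (h24 : ∀ j, lev₂ j ≠ 24)
    (h60 : ∀ j, lev₂ j ≠ 60) (hΨ : ∀ j (σ : F j →+* ℂ), σ ∈ (Ψ j).1 ↔ 2 * (expOf (lev₂ j) (F j) σ).val < lev₂ j)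
    (hC : ∀ j, IsCMTypeRealisation (Ψ j) (C j) (ιC j) (θC j)) :
    ∀ a b : Fin 5, a ≠ b →
      ∀ f : (![A₂₀, A₆₀, ⨁ fun l : Fin 2 => (![A₄, A₁₂] : Fin 2 → AbelianVariety ℂ) l,
              ⨁ fun i => ⨁ fun l : Fin 2 => (![A i, A' i] : Fin 2 → AbelianVariety ℂ) l, ⨁ C] : Fin 5 → AbelianVariety ℂ) a ⟶
        (![A₂₀, A₆₀, ⨁ fun l : Fin 2 => (![A₄, A₁₂] : Fin 2 → AbelianVariety ℂ) l,
           ⨁ fun i => ⨁ fun l : Fin 2 => (![A i, A' i] : Fin 2 → AbelianVariety ℂ) l, ⨁ C] : Fin 5 → AbelianVariety ℂ) b, f = 0 :=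
  hom_eq_zero_vecCons (X := A₂₀)
    (F := (![A₆₀, ⨁ fun l : Fin 2 => (![A₄, A₁₂] : Fin 2 → AbelianVariety ℂ) l,
      ⨁ fun i => ⨁ fun l : Fin 2 => (![A i, A' i] : Fin 2 → AbelianVariety ℂ) l, ⨁ C] : Fin 4 → AbelianVariety ℂ))
    (hom_eq_zero_twenty_blocks hodd hdvd h1 hΦ hΦL hA hA' hA₄ hΦ₁₂ hA₁₂ hΦ₂₀ hA₂₀ hΦ₆₀ hA₆₀ h4 h8 h20 h24 h60 hΨ hC)
    (hom_eq_zero_vecCons (X := A₆₀)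
      (F := (![⨁ fun l : Fin 2 => (![A₄, A₁₂] : Fin 2 → AbelianVariety ℂ) l,
        ⨁ fun i => ⨁ fun l : Fin 2 => (![A i, A' i] : Fin 2 → AbelianVariety ℂ) l, ⨁ C] : Fin 3 → AbelianVariety ℂ))
      (hom_eq_zero_sixty_blocks hodd hdvd h1 hΦ hΦL hA hA' hA₄ hΦ₁₂ hA₁₂ hΦ₆₀ hA₆₀ h4 h8 h20 h24 h60 hΨ hC)
      (hom_eq_zero_blocks_twelveTimesOdd hodd hdvd h1 hΦ hΦL hA hA' hA₄ hΦ₁₂ hA₁₂ h4 h8 h12 h20 h24 h60 hΨ hC))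

/-- The product of five algebras indexed by `Fin 5`. [folklore] -/
private theorem nonempty_pi_fin_five_algEquiv_prod₆₀ (T : Fin 5 → Type) [∀ i, Ring (T i)] [∀ i, Algebra ℚ (T i)] :
    Nonempty ((∀ i, T i) ≃ₐ[ℚ] T 0 × (T 1 × (T 2 × (T 3 × T 4)))) := by
  refine ⟨AlgEquiv.ofBijective
    ((Pi.evalAlgHom ℚ T 0).prod ((Pi.evalAlgHom ℚ T 1).prod ((Pi.evalAlgHom ℚ T 2).prod ((Pi.evalAlgHom ℚ T 3).prod
      (Pi.evalAlgHom ℚ T 4)))))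
    ⟨fun f g h => ?_, fun x => ?_⟩⟩
  · simp only [AlgHom.prod_apply, Pi.evalAlgHom_apply, Prod.mk.injEq] at h
    funext i
    match i with
    | ⟨0, _⟩ => exact h.1
    | ⟨1, _⟩ => exact h.2.1
    | ⟨2, _⟩ => exact h.2.2.1
    | ⟨3, _⟩ => exact h.2.2.2.1
    | ⟨4, _⟩ => exact h.2.2.2.2
  · exact ⟨Fin.cons x.1 (Fin.cons x.2.1 (Fin.cons x.2.2.1 (Fin.cons x.2.2.2.1 (Fin.cons x.2.2.2.2 finZeroElim)))), rfl⟩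

/-- **GGL THM. 3.0 + LEMMA 14 at the levels `60 ∣ m`, `8 ∤ m` (family form):
`End⁰(J_m) ≃ₐ[ℚ] Mat₄(ℚ(r₂₀)) × (Mat₄(ℚ(r₆₀)) × (Mat₃(ℚ(ζ_4)) × ((∏_i Mat₂(ℚ(ζ_{d_i}))) × ∏_j Mat₂(ℚ(ζ_{e_j} − ζ_{e_j}⁻¹)))))`**, `r₂₀² = −5`,
`r₆₀⁴ + 15 r₆₀² + 45 = 0` (`[ℚ(r₆₀) : ℚ] = 4`), on the carrier `![A₂₀, A₆₀, A₄ ⊕ A₁₂, ⨁_i (A_i ⊕ A′_i), ⨁_j C_j]`.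
[cite: GalleseGoodsonLombardo2024, §3.5 Lemma 14 and the sentence following it; §3 Thm. 3.0 (4), (5), last statement; §3.4]
[cite: MumfordAV1970, §19 Cor. 2 of Thm. 3 and p. 174] [cite: Shimura1998, §5.1 Prop. 3, 4 (proofs) and Prop. 6] -/
theorem nonempty_endAlgebra_algEquiv_sixtyDvd [NeZero M] (hodd : Odd M) (hdvd : ∀ i, lev₁ i ∣ M) (hinj₁ : Function.Injective lev₁)
    (h1 : ∀ i, 1 < lev₁ i) (hΦ : ∀ i (σ : K i →+* ℂ), σ ∈ (Φ i).1 ↔ 2 * (expOf (lev₁ i) (K i) σ).val < lev₁ i)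
    (hΦL : ∀ i (σ : L i →+* ℂ), σ ∈ (ΦL i).1 ↔ 2 * (expOf (2 * lev₁ i) (L i) σ).val < 2 * lev₁ i)
    (hA : ∀ i, IsCMTypeRealisation (Φ i) (A i) (ι i) (θ i)) (hA' : ∀ i, IsCMTypeRealisation (ΦL i) (A' i) (ι' i) (θ' i))
    (hΦ₄ : ∀ σ : K₄ →+* ℂ, σ ∈ Φ₄.1 ↔ 2 * (expOf 4 K₄ σ).val < 4) (hA₄ : IsCMTypeRealisation Φ₄ A₄ ι₄ θ₄)
    (hΦ₁₂ : ∀ σ : K₁₂ →+* ℂ, σ ∈ Φ₁₂.1 ↔ 2 * (expOf 12 K₁₂ σ).val < 12) (hA₁₂ : IsCMTypeRealisation Φ₁₂ A₁₂ ι₁₂ θ₁₂)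
    (hΦ₂₀ : ∀ σ : K₂₀ →+* ℂ, σ ∈ Φ₂₀.1 ↔ 2 * (expOf 20 K₂₀ σ).val < 20) (hA₂₀ : IsCMTypeRealisation Φ₂₀ A₂₀ ι₂₀ θ₂₀)
    (hΦ₆₀ : ∀ σ : K₆₀ →+* ℂ, σ ∈ Φ₆₀.1 ↔ 2 * (expOf 60 K₆₀ σ).val < 60) (hA₆₀ : IsCMTypeRealisation Φ₆₀ A₆₀ ι₆₀ θ₆₀)
    (h4 : ∀ j, 4 ∣ lev₂ j) (h8 : ∀ j, 8 ≤ lev₂ j) (h12 : ∀ j, lev₂ j ≠ 12) (h20 : ∀ j, lev₂ j ≠ 20) (h24 : ∀ j, lev₂ j ≠ 24)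
    (h60 : ∀ j, lev₂ j ≠ 60) (hinj₂ : Function.Injective lev₂)
    (hΨ : ∀ j (σ : F j →+* ℂ), σ ∈ (Ψ j).1 ↔ 2 * (expOf (lev₂ j) (F j) σ).val < lev₂ j)
    (hC : ∀ j, IsCMTypeRealisation (Ψ j) (C j) (ιC j) (θC j)) :
    Nonempty ((⨁ fun a : Fin 5 =>
        (![A₂₀, A₆₀, ⨁ fun l : Fin 2 => (![A₄, A₁₂] : Fin 2 → AbelianVariety ℂ) l,
           ⨁ fun i => ⨁ fun l : Fin 2 => (![A i, A' i] : Fin 2 → AbelianVariety ℂ) l, ⨁ C] : Fin 5 → AbelianVariety ℂ) a).endAlgebra ≃ₐ[ℚ]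
      Matrix (Fin 4) (Fin 4) (IntermediateField.adjoin ℚ {zetaOf 20 K₂₀ + zetaOf 20 K₂₀ ^ 3 + zetaOf 20 K₂₀ ^ 7 + zetaOf 20 K₂₀ ^ 9}) ×
        (Matrix (Fin 4) (Fin 4) (IntermediateField.adjoin ℚ {zetaOf 60 K₆₀ + zetaOf 60 K₆₀ ^ 11 + zetaOf 60 K₆₀ ^ 19 + zetaOf 60 K₆₀ ^ 29}) ×
          (Matrix (Fin 3) (Fin 3) K₄ × ((∀ i, Matrix (Fin 2) (Fin 2) (K i)) ×
            (∀ j, Matrix (Fin 2) (Fin 2) (IntermediateField.adjoin ℚ {zetaOf (lev₂ j) (F j) - (zetaOf (lev₂ j) (F j))⁻¹})))))) := by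
  classical
  obtain ⟨E, -⟩ := AbelianVariety.nonempty_algEquiv_endAlgebra_biproduct_pi
    (A := fun a : Fin 5 => (![A₂₀, A₆₀, ⨁ fun l : Fin 2 => (![A₄, A₁₂] : Fin 2 → AbelianVariety ℂ) l,
      ⨁ fun i => ⨁ fun l : Fin 2 => (![A i, A' i] : Fin 2 → AbelianVariety ℂ) l, ⨁ C] : Fin 5 → AbelianVariety ℂ) a)
    (hom_eq_zero_blocks_sixtyDvd hodd hdvd h1 hΦ hΦL hA hA' hA₄ hΦ₁₂ hA₁₂ hΦ₂₀ hA₂₀ hΦ₆₀ hA₆₀ h4 h8 h12 h20 h24 h60 hΨ hC)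
  obtain ⟨P⟩ := nonempty_pi_fin_five_algEquiv_prod₆₀
    (fun a : Fin 5 => ((![A₂₀, A₆₀, ⨁ fun l : Fin 2 => (![A₄, A₁₂] : Fin 2 → AbelianVariety ℂ) l,
      ⨁ fun i => ⨁ fun l : Fin 2 => (![A i, A' i] : Fin 2 → AbelianVariety ℂ) l, ⨁ C] : Fin 5 → AbelianVariety ℂ) a).endAlgebra)
  obtain ⟨-, -, -, ⟨e₂₀⟩, -⟩ := nonempty_matrix_four_algEquiv_endAlgebra_twenty Φ₂₀ hΦ₂₀ hA₂₀
  obtain ⟨-, -, -, ⟨e₆₀⟩, -⟩ := nonempty_matrix_four_algEquiv_endAlgebra_sixty Φ₆₀ hΦ₆₀ hA₆₀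
  obtain ⟨e₀⟩ := nonempty_endAlgebra_four_twelve_algEquiv_matrix hΦ₄ hA₄ hΦ₁₂ hA₁₂
  obtain ⟨e₁⟩ := nonempty_endAlgebra_algEquiv_pi_matrix_twiceOdd hodd hdvd hinj₁ h1 hΦ hΦL hA hA'
  obtain ⟨e₂⟩ := nonempty_endAlgebra_biproduct_algEquiv_pi_fourDvd h4 h8 h20 h24 h60 hinj₂ hΨ hC
  exact ⟨(E.trans P).trans (AlgEquiv.prodCongr e₂₀.symm (AlgEquiv.prodCongr e₆₀.symm
    (AlgEquiv.prodCongr e₀ (AlgEquiv.prodCongr e₁ e₂))))⟩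

/-- **Dimension count at the levels `60 ∣ m`, `8 ∤ m`: `dim_ℚ End⁰(J) = 114 + 4 Σ_i φ(d_i) + 2 Σ_j φ(e_j)` and `2 dim J = 30 + 2 Σ_i φ(d_i) + Σ_j φ(e_j)`**
(`m = 60`: `170`, `g = 29` (F20); `m = 180`: `410`, `g = 89`; `m = 300`: `114 + 4·74 + 2·120 = 650`, `g = 149`).
[cite: GalleseGoodsonLombardo2024, §3 Thm. 3.0 («dim X_d = φ(d)/2») and §3.5 Lemma 14] [cite: MumfordAV1970, §19 Cor. 2 of Thm. 3] -/
theorem finrank_endAlgebra_sixtyDvd [NeZero M] (hodd : Odd M) (hdvd : ∀ i, lev₁ i ∣ M) (hinj₁ : Function.Injective lev₁)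
    (h1 : ∀ i, 1 < lev₁ i) (hΦ : ∀ i (σ : K i →+* ℂ), σ ∈ (Φ i).1 ↔ 2 * (expOf (lev₁ i) (K i) σ).val < lev₁ i)
    (hΦL : ∀ i (σ : L i →+* ℂ), σ ∈ (ΦL i).1 ↔ 2 * (expOf (2 * lev₁ i) (L i) σ).val < 2 * lev₁ i)
    (hA : ∀ i, IsCMTypeRealisation (Φ i) (A i) (ι i) (θ i)) (hA' : ∀ i, IsCMTypeRealisation (ΦL i) (A' i) (ι' i) (θ' i))
    (hΦ₄ : ∀ σ : K₄ →+* ℂ, σ ∈ Φ₄.1 ↔ 2 * (expOf 4 K₄ σ).val < 4) (hA₄ : IsCMTypeRealisation Φ₄ A₄ ι₄ θ₄)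
    (hΦ₁₂ : ∀ σ : K₁₂ →+* ℂ, σ ∈ Φ₁₂.1 ↔ 2 * (expOf 12 K₁₂ σ).val < 12) (hA₁₂ : IsCMTypeRealisation Φ₁₂ A₁₂ ι₁₂ θ₁₂)
    (hΦ₂₀ : ∀ σ : K₂₀ →+* ℂ, σ ∈ Φ₂₀.1 ↔ 2 * (expOf 20 K₂₀ σ).val < 20) (hA₂₀ : IsCMTypeRealisation Φ₂₀ A₂₀ ι₂₀ θ₂₀)
    (hΦ₆₀ : ∀ σ : K₆₀ →+* ℂ, σ ∈ Φ₆₀.1 ↔ 2 * (expOf 60 K₆₀ σ).val < 60) (hA₆₀ : IsCMTypeRealisation Φ₆₀ A₆₀ ι₆₀ θ₆₀)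
    (h4 : ∀ j, 4 ∣ lev₂ j) (h8 : ∀ j, 8 ≤ lev₂ j) (h12 : ∀ j, lev₂ j ≠ 12) (h20 : ∀ j, lev₂ j ≠ 20) (h24 : ∀ j, lev₂ j ≠ 24)
    (h60 : ∀ j, lev₂ j ≠ 60) (hinj₂ : Function.Injective lev₂)
    (hΨ : ∀ j (σ : F j →+* ℂ), σ ∈ (Ψ j).1 ↔ 2 * (expOf (lev₂ j) (F j) σ).val < lev₂ j)
    (hC : ∀ j, IsCMTypeRealisation (Ψ j) (C j) (ιC j) (θC j)) :
    finrank ℚ (⨁ fun a : Fin 5 =>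
        (![A₂₀, A₆₀, ⨁ fun l : Fin 2 => (![A₄, A₁₂] : Fin 2 → AbelianVariety ℂ) l,
           ⨁ fun i => ⨁ fun l : Fin 2 => (![A i, A' i] : Fin 2 → AbelianVariety ℂ) l, ⨁ C] : Fin 5 → AbelianVariety ℂ) a).endAlgebra =
      114 + 4 * ∑ i, Nat.totient (lev₁ i) + 2 * ∑ j, Nat.totient (lev₂ j) ∧
    2 * (⨁ fun a : Fin 5 =>
        (![A₂₀, A₆₀, ⨁ fun l : Fin 2 => (![A₄, A₁₂] : Fin 2 → AbelianVariety ℂ) l,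
           ⨁ fun i => ⨁ fun l : Fin 2 => (![A i, A' i] : Fin 2 → AbelianVariety ℂ) l, ⨁ C] : Fin 5 → AbelianVariety ℂ) a).dim =
      30 + 2 * ∑ i, Nat.totient (lev₁ i) + ∑ j, Nat.totient (lev₂ j) := by
  classical
  obtain ⟨hfr₃, hdim₃⟩ := finrank_endAlgebra_twelveTimesOdd hodd hdvd hinj₁ h1 hΦ hΦL hA hA' hΦ₄ hA₄ hΦ₁₂ hA₁₂ h4 h8 h12 h20 h24 h60
    hinj₂ hΨ hC
  obtain ⟨hd₂₀, -, -, ⟨e₂₀⟩, -, hfr₂₀, -⟩ := nonempty_matrix_four_algEquiv_endAlgebra_twenty Φ₂₀ hΦ₂₀ hA₂₀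
  obtain ⟨hd₆₀, -, -, ⟨e₆₀⟩, -, hfr₆₀, -⟩ := nonempty_matrix_four_algEquiv_endAlgebra_sixty Φ₆₀ hΦ₆₀ hA₆₀
  refine ⟨?_, ?_⟩
  · obtain ⟨e⟩ := nonempty_endAlgebra_algEquiv_sixtyDvd hodd hdvd hinj₁ h1 hΦ hΦL hA hA' hΦ₄ hA₄ hΦ₁₂ hA₁₂ hΦ₂₀ hA₂₀ hΦ₆₀ hA₆₀ h4 h8
      h12 h20 h24 h60 hinj₂ hΨ hC
    obtain ⟨e'⟩ := nonempty_endAlgebra_algEquiv_twelveTimesOdd hodd hdvd hinj₁ h1 hΦ hΦL hA hA' hΦ₄ hA₄ hΦ₁₂ hA₁₂ h4 h8 h12 h20 h24 h60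
      hinj₂ hΨ hC
    haveI : ∀ j, FiniteDimensional ℚ (IntermediateField.adjoin ℚ {zetaOf (lev₂ j) (F j) - (zetaOf (lev₂ j) (F j))⁻¹}) := fun j =>
      IntermediateField.finiteDimensional_left _
    haveI : ∀ j, Module.Finite ℚ (Matrix (Fin 2) (Fin 2)
        (IntermediateField.adjoin ℚ {zetaOf (lev₂ j) (F j) - (zetaOf (lev₂ j) (F j))⁻¹})) := fun j => Module.Finite.matrix
    haveI : ∀ j, Module.Free ℚ (Matrix (Fin 2) (Fin 2)
        (IntermediateField.adjoin ℚ {zetaOf (lev₂ j) (F j) - (zetaOf (lev₂ j) (F j))⁻¹})) := fun j => inferInstance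
    haveI : ∀ i, Module.Finite ℚ (Matrix (Fin 2) (Fin 2) (K i)) := fun i => Module.Finite.matrix
    haveI : ∀ i, Module.Free ℚ (Matrix (Fin 2) (Fin 2) (K i)) := fun i => inferInstance
    haveI : Module.Finite ℚ (∀ j, Matrix (Fin 2) (Fin 2)
        (IntermediateField.adjoin ℚ {zetaOf (lev₂ j) (F j) - (zetaOf (lev₂ j) (F j))⁻¹})) := inferInstance
    haveI : Module.Free ℚ (∀ j, Matrix (Fin 2) (Fin 2)
        (IntermediateField.adjoin ℚ {zetaOf (lev₂ j) (F j) - (zetaOf (lev₂ j) (F j))⁻¹})) := inferInstance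
    haveI : Module.Finite ℚ (∀ i, Matrix (Fin 2) (Fin 2) (K i)) := inferInstance
    haveI : Module.Free ℚ (∀ i, Matrix (Fin 2) (Fin 2) (K i)) := inferInstance
    haveI : Module.Finite ℚ ((∀ i, Matrix (Fin 2) (Fin 2) (K i)) × (∀ j, Matrix (Fin 2) (Fin 2)
        (IntermediateField.adjoin ℚ {zetaOf (lev₂ j) (F j) - (zetaOf (lev₂ j) (F j))⁻¹}))) := inferInstance
    haveI : Module.Free ℚ ((∀ i, Matrix (Fin 2) (Fin 2) (K i)) × (∀ j, Matrix (Fin 2) (Fin 2)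
        (IntermediateField.adjoin ℚ {zetaOf (lev₂ j) (F j) - (zetaOf (lev₂ j) (F j))⁻¹}))) := inferInstance
    haveI : Module.Finite ℚ (Matrix (Fin 3) (Fin 3) K₄) := Module.Finite.matrix
    haveI : Module.Free ℚ (Matrix (Fin 3) (Fin 3) K₄) := inferInstance
    haveI : Module.Finite ℚ (Matrix (Fin 3) (Fin 3) K₄ × ((∀ i, Matrix (Fin 2) (Fin 2) (K i)) × (∀ j, Matrix (Fin 2) (Fin 2)
        (IntermediateField.adjoin ℚ {zetaOf (lev₂ j) (F j) - (zetaOf (lev₂ j) (F j))⁻¹})))) := inferInstance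
    haveI : Module.Free ℚ (Matrix (Fin 3) (Fin 3) K₄ × ((∀ i, Matrix (Fin 2) (Fin 2) (K i)) × (∀ j, Matrix (Fin 2) (Fin 2)
        (IntermediateField.adjoin ℚ {zetaOf (lev₂ j) (F j) - (zetaOf (lev₂ j) (F j))⁻¹})))) := inferInstance
    haveI : FiniteDimensional ℚ (IntermediateField.adjoin ℚ {zetaOf 60 K₆₀ + zetaOf 60 K₆₀ ^ 11 + zetaOf 60 K₆₀ ^ 19 + zetaOf 60 K₆₀ ^ 29}) :=
      IntermediateField.finiteDimensional_left _
    haveI : Module.Finite ℚ (Matrix (Fin 4) (Fin 4)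
        (IntermediateField.adjoin ℚ {zetaOf 60 K₆₀ + zetaOf 60 K₆₀ ^ 11 + zetaOf 60 K₆₀ ^ 19 + zetaOf 60 K₆₀ ^ 29})) := Module.Finite.matrix
    haveI : Module.Free ℚ (Matrix (Fin 4) (Fin 4)
        (IntermediateField.adjoin ℚ {zetaOf 60 K₆₀ + zetaOf 60 K₆₀ ^ 11 + zetaOf 60 K₆₀ ^ 19 + zetaOf 60 K₆₀ ^ 29})) := inferInstance
    haveI : Module.Finite ℚ (Matrix (Fin 4) (Fin 4)
        (IntermediateField.adjoin ℚ {zetaOf 60 K₆₀ + zetaOf 60 K₆₀ ^ 11 + zetaOf 60 K₆₀ ^ 19 + zetaOf 60 K₆₀ ^ 29}) ×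
        (Matrix (Fin 3) (Fin 3) K₄ × ((∀ i, Matrix (Fin 2) (Fin 2) (K i)) × (∀ j, Matrix (Fin 2) (Fin 2)
          (IntermediateField.adjoin ℚ {zetaOf (lev₂ j) (F j) - (zetaOf (lev₂ j) (F j))⁻¹}))))) := inferInstance
    haveI : Module.Free ℚ (Matrix (Fin 4) (Fin 4)
        (IntermediateField.adjoin ℚ {zetaOf 60 K₆₀ + zetaOf 60 K₆₀ ^ 11 + zetaOf 60 K₆₀ ^ 19 + zetaOf 60 K₆₀ ^ 29}) ×
        (Matrix (Fin 3) (Fin 3) K₄ × ((∀ i, Matrix (Fin 2) (Fin 2) (K i)) × (∀ j, Matrix (Fin 2) (Fin 2)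
          (IntermediateField.adjoin ℚ {zetaOf (lev₂ j) (F j) - (zetaOf (lev₂ j) (F j))⁻¹}))))) := inferInstance
    haveI : FiniteDimensional ℚ (IntermediateField.adjoin ℚ {zetaOf 20 K₂₀ + zetaOf 20 K₂₀ ^ 3 + zetaOf 20 K₂₀ ^ 7 + zetaOf 20 K₂₀ ^ 9}) :=
      IntermediateField.finiteDimensional_left _
    haveI : Module.Finite ℚ (Matrix (Fin 4) (Fin 4)
        (IntermediateField.adjoin ℚ {zetaOf 20 K₂₀ + zetaOf 20 K₂₀ ^ 3 + zetaOf 20 K₂₀ ^ 7 + zetaOf 20 K₂₀ ^ 9})) := Module.Finite.matrix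
    haveI : Module.Free ℚ (Matrix (Fin 4) (Fin 4)
        (IntermediateField.adjoin ℚ {zetaOf 20 K₂₀ + zetaOf 20 K₂₀ ^ 3 + zetaOf 20 K₂₀ ^ 7 + zetaOf 20 K₂₀ ^ 9})) := inferInstance
    have hrest : finrank ℚ (Matrix (Fin 3) (Fin 3) K₄ × ((∀ i, Matrix (Fin 2) (Fin 2) (K i)) × (∀ j, Matrix (Fin 2) (Fin 2)
        (IntermediateField.adjoin ℚ {zetaOf (lev₂ j) (F j) - (zetaOf (lev₂ j) (F j))⁻¹})))) =
        18 + 4 * ∑ i, Nat.totient (lev₁ i) + 2 * ∑ j, Nat.totient (lev₂ j) := by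
      rw [← e'.toLinearEquiv.finrank_eq, hfr₃]
    have h20' : finrank ℚ (Matrix (Fin 4) (Fin 4)
        (IntermediateField.adjoin ℚ {zetaOf 20 K₂₀ + zetaOf 20 K₂₀ ^ 3 + zetaOf 20 K₂₀ ^ 7 + zetaOf 20 K₂₀ ^ 9})) = 32 := by
      rw [e₂₀.toLinearEquiv.finrank_eq, hfr₂₀]
    have h60' : finrank ℚ (Matrix (Fin 4) (Fin 4)
        (IntermediateField.adjoin ℚ {zetaOf 60 K₆₀ + zetaOf 60 K₆₀ ^ 11 + zetaOf 60 K₆₀ ^ 19 + zetaOf 60 K₆₀ ^ 29})) = 64 := by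
      rw [e₆₀.toLinearEquiv.finrank_eq, hfr₆₀]
    rw [e.toLinearEquiv.finrank_eq, Module.finrank_prod, Module.finrank_prod, h20', h60', hrest]
    omega
  · have h3 : 2 * (⨁ fun a : Fin 3 => (![⨁ fun l : Fin 2 => (![A₄, A₁₂] : Fin 2 → AbelianVariety ℂ) l,
        ⨁ fun i => ⨁ fun l : Fin 2 => (![A i, A' i] : Fin 2 → AbelianVariety ℂ) l, ⨁ C] : Fin 3 → AbelianVariety ℂ) a).dim =
        2 * ((⨁ fun l : Fin 2 => (![A₄, A₁₂] : Fin 2 → AbelianVariety ℂ) l).dim +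
          (⨁ fun i => ⨁ fun l : Fin 2 => (![A i, A' i] : Fin 2 → AbelianVariety ℂ) l).dim + (⨁ C).dim) := by
      rw [AbelianVariety.dim_biproduct, Fin.sum_univ_three]
      rfl
    rw [AbelianVariety.dim_biproduct, Fin.sum_univ_five]
    show 2 * (A₂₀.dim + A₆₀.dim + (⨁ fun l : Fin 2 => (![A₄, A₁₂] : Fin 2 → AbelianVariety ℂ) l).dim +
        (⨁ fun i => ⨁ fun l : Fin 2 => (![A i, A' i] : Fin 2 → AbelianVariety ℂ) l).dim + (⨁ C).dim) =
      30 + 2 * ∑ i, Nat.totient (lev₁ i) + ∑ j, Nat.totient (lev₂ j)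
    rw [hd₂₀, hd₆₀]
    omega

/-! ## §3 The levels `120 ∣ m` -/

/-- **The six parts `Y_{20}`, `Y_{60}`, `Y_{24}`-blocks, `X_4 ⊕ X_{12}`, `⨁_i (X_{d_i} ⊕ X_{2d_i})`, `⨁_j X_{e_j}` of `J_m` (`120 ∣ m`) are pairwise
orthogonal** (`Y_{20} ⟂ Y_{24}`: F17; `Y_{24} ⟂ Y_{60}`: F23; the rest §2 and F26).
[cite: GalleseGoodsonLombardo2024, §3 Thm. 3.0 (last statement)] [cite: MilneCM2006, Ch. I §3 Prop. 3.13] -/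
theorem hom_eq_zero_blocks_hundredTwentyDvd (hodd : Odd M) (hdvd : ∀ i, lev₁ i ∣ M) (h1 : ∀ i, 1 < lev₁ i)
    (hΦ : ∀ i (σ : K i →+* ℂ), σ ∈ (Φ i).1 ↔ 2 * (expOf (lev₁ i) (K i) σ).val < lev₁ i)
    (hΦL : ∀ i (σ : L i →+* ℂ), σ ∈ (ΦL i).1 ↔ 2 * (expOf (2 * lev₁ i) (L i) σ).val < 2 * lev₁ i)
    (hA : ∀ i, IsCMTypeRealisation (Φ i) (A i) (ι i) (θ i)) (hA' : ∀ i, IsCMTypeRealisation (ΦL i) (A' i) (ι' i) (θ' i))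
    (hA₄ : IsCMTypeRealisation Φ₄ A₄ ι₄ θ₄)
    (hΦ₁₂ : ∀ σ : K₁₂ →+* ℂ, σ ∈ Φ₁₂.1 ↔ 2 * (expOf 12 K₁₂ σ).val < 12) (hA₁₂ : IsCMTypeRealisation Φ₁₂ A₁₂ ι₁₂ θ₁₂)
    (hΦ₂₀ : ∀ σ : K₂₀ →+* ℂ, σ ∈ Φ₂₀.1 ↔ 2 * (expOf 20 K₂₀ σ).val < 20) (hA₂₀ : IsCMTypeRealisation Φ₂₀ A₂₀ ι₂₀ θ₂₀)
    (hΦ₆₀ : ∀ σ : K₆₀ →+* ℂ, σ ∈ Φ₆₀.1 ↔ 2 * (expOf 60 K₆₀ σ).val < 60) (hA₆₀ : IsCMTypeRealisation Φ₆₀ A₆₀ ι₆₀ θ₆₀)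
    (hΦ₂₄ : ∀ σ : K₂₄ →+* ℂ, σ ∈ Φ₂₄.1 ↔ 2 * (expOf 24 K₂₄ σ).val < 24) (hA₂₄ : IsCMTypeRealisation Φ₂₄ A₂₄ ι₂₄ θ₂₄)
    (h4 : ∀ j, 4 ∣ lev₂ j) (h8 : ∀ j, 8 ≤ lev₂ j) (h12 : ∀ j, lev₂ j ≠ 12) (h20 : ∀ j, lev₂ j ≠ 20) (h24 : ∀ j, lev₂ j ≠ 24)
    (h60 : ∀ j, lev₂ j ≠ 60) (hΨ : ∀ j (σ : F j →+* ℂ), σ ∈ (Ψ j).1 ↔ 2 * (expOf (lev₂ j) (F j) σ).val < lev₂ j)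
    (hC : ∀ j, IsCMTypeRealisation (Ψ j) (C j) (ιC j) (θC j)) :
    ∀ a b : Fin 6, a ≠ b →
      ∀ f : (![A₂₀, A₆₀, A₂₄, ⨁ fun l : Fin 2 => (![A₄, A₁₂] : Fin 2 → AbelianVariety ℂ) l,
              ⨁ fun i => ⨁ fun l : Fin 2 => (![A i, A' i] : Fin 2 → AbelianVariety ℂ) l, ⨁ C] : Fin 6 → AbelianVariety ℂ) a ⟶
        (![A₂₀, A₆₀, A₂₄, ⨁ fun l : Fin 2 => (![A₄, A₁₂] : Fin 2 → AbelianVariety ℂ) l,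
           ⨁ fun i => ⨁ fun l : Fin 2 => (![A i, A' i] : Fin 2 → AbelianVariety ℂ) l, ⨁ C] : Fin 6 → AbelianVariety ℂ) b, f = 0 := by
  classical
  have o2024 := orthogonal_twenty_twentyFour hΦ₂₀ hA₂₀ hΦ₂₄ hA₂₄
  have o2460 := orthogonal_twentyFour_sixty hΦ₂₄ hA₂₄ hΦ₆₀ hA₆₀
  have h20col := hom_eq_zero_twenty_blocks hodd hdvd h1 hΦ hΦL hA hA' hA₄ hΦ₁₂ hA₁₂ hΦ₂₀ hA₂₀ hΦ₆₀ hA₆₀ h4 h8 h20 h24 h60 hΨ hC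
  have h60col := hom_eq_zero_sixty_blocks hodd hdvd h1 hΦ hΦL hA hA' hA₄ hΦ₁₂ hA₁₂ hΦ₆₀ hA₆₀ h4 h8 h20 h24 h60 hΨ hC
  -- `Y_{60}` against the F26 carrier `![A₂₄, F25 blocks]`
  have g60 : ∀ l, (∀ u : A₆₀ ⟶ (![A₂₄, ⨁ fun l : Fin 2 => (![A₄, A₁₂] : Fin 2 → AbelianVariety ℂ) l,
        ⨁ fun i => ⨁ fun l : Fin 2 => (![A i, A' i] : Fin 2 → AbelianVariety ℂ) l, ⨁ C] : Fin 4 → AbelianVariety ℂ) l, u = 0) ∧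
      (∀ v : (![A₂₄, ⨁ fun l : Fin 2 => (![A₄, A₁₂] : Fin 2 → AbelianVariety ℂ) l,
        ⨁ fun i => ⨁ fun l : Fin 2 => (![A i, A' i] : Fin 2 → AbelianVariety ℂ) l, ⨁ C] : Fin 4 → AbelianVariety ℂ) l ⟶ A₆₀, v = 0) :=
    Fin.cons ⟨o2460.2.1, o2460.1⟩ h60col
  -- `Y_{20}` against `![A₆₀, A₂₄, F25 blocks]`
  have g20 : ∀ l, (∀ u : A₂₀ ⟶ (![A₆₀, A₂₄, ⨁ fun l : Fin 2 => (![A₄, A₁₂] : Fin 2 → AbelianVariety ℂ) l,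
        ⨁ fun i => ⨁ fun l : Fin 2 => (![A i, A' i] : Fin 2 → AbelianVariety ℂ) l, ⨁ C] : Fin 5 → AbelianVariety ℂ) l, u = 0) ∧
      (∀ v : (![A₆₀, A₂₄, ⨁ fun l : Fin 2 => (![A₄, A₁₂] : Fin 2 → AbelianVariety ℂ) l,
        ⨁ fun i => ⨁ fun l : Fin 2 => (![A i, A' i] : Fin 2 → AbelianVariety ℂ) l, ⨁ C] : Fin 5 → AbelianVariety ℂ) l ⟶ A₂₀, v = 0) :=
    Fin.cons (h20col 0) (Fin.cons ⟨o2024.1, o2024.2.1⟩ (Fin.tail h20col))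
  exact hom_eq_zero_vecCons (X := A₂₀)
    (F := (![A₆₀, A₂₄, ⨁ fun l : Fin 2 => (![A₄, A₁₂] : Fin 2 → AbelianVariety ℂ) l,
      ⨁ fun i => ⨁ fun l : Fin 2 => (![A i, A' i] : Fin 2 → AbelianVariety ℂ) l, ⨁ C] : Fin 5 → AbelianVariety ℂ)) g20
    (hom_eq_zero_vecCons (X := A₆₀)
      (F := (![A₂₄, ⨁ fun l : Fin 2 => (![A₄, A₁₂] : Fin 2 → AbelianVariety ℂ) l,
        ⨁ fun i => ⨁ fun l : Fin 2 => (![A i, A' i] : Fin 2 → AbelianVariety ℂ) l, ⨁ C] : Fin 4 → AbelianVariety ℂ)) g60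
      (hom_eq_zero_blocks_twentyFourDvd hodd hdvd h1 hΦ hΦL hA hA' hA₄ hΦ₁₂ hA₁₂ hΦ₂₄ hA₂₄ h4 h8 h12 h20 h24 h60 hΨ hC))

/-- The product of six algebras indexed by `Fin 6`. [folklore] -/
private theorem nonempty_pi_fin_six_algEquiv_prod₆₀ (T : Fin 6 → Type) [∀ i, Ring (T i)] [∀ i, Algebra ℚ (T i)] :
    Nonempty ((∀ i, T i) ≃ₐ[ℚ] T 0 × (T 1 × (T 2 × (T 3 × (T 4 × T 5))))) := by
  refine ⟨AlgEquiv.ofBijective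
    ((Pi.evalAlgHom ℚ T 0).prod ((Pi.evalAlgHom ℚ T 1).prod ((Pi.evalAlgHom ℚ T 2).prod ((Pi.evalAlgHom ℚ T 3).prod
      ((Pi.evalAlgHom ℚ T 4).prod (Pi.evalAlgHom ℚ T 5))))))
    ⟨fun f g h => ?_, fun x => ?_⟩⟩
  · simp only [AlgHom.prod_apply, Pi.evalAlgHom_apply, Prod.mk.injEq] at h
    funext i
    match i with
    | ⟨0, _⟩ => exact h.1
    | ⟨1, _⟩ => exact h.2.1
    | ⟨2, _⟩ => exact h.2.2.1
    | ⟨3, _⟩ => exact h.2.2.2.1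
    | ⟨4, _⟩ => exact h.2.2.2.2.1
    | ⟨5, _⟩ => exact h.2.2.2.2.2
  · exact ⟨Fin.cons x.1 (Fin.cons x.2.1 (Fin.cons x.2.2.1 (Fin.cons x.2.2.2.1 (Fin.cons x.2.2.2.2.1
      (Fin.cons x.2.2.2.2.2 finZeroElim))))), rfl⟩

/-- **GGL THM. 3.0 + LEMMA 14 at the levels `120 ∣ m` (family form):
`End⁰(J_m) ≃ₐ[ℚ] Mat₄(ℚ(r₂₀)) × (Mat₄(ℚ(r₆₀)) × (Mat₄(ℚ(r₂₄)) × (Mat₃(ℚ(ζ_4)) × ((∏_i Mat₂(ℚ(ζ_{d_i}))) × ∏_j Mat₂(ℚ(ζ_{e_j} − ζ_{e_j}⁻¹))))))`**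
on the carrier `![A₂₀, A₆₀, A₂₄, A₄ ⊕ A₁₂, ⨁_i (A_i ⊕ A′_i), ⨁_j C_j]`.
[cite: GalleseGoodsonLombardo2024, §3.5 Lemma 14 and the sentence following it; §3 Thm. 3.0 (4), (5), last statement; §3.4]
[cite: MumfordAV1970, §19 Cor. 2 of Thm. 3 and p. 174] [cite: Shimura1998, §5.1 Prop. 3, 4 (proofs) and Prop. 6] -/
theorem nonempty_endAlgebra_algEquiv_hundredTwentyDvd [NeZero M] (hodd : Odd M) (hdvd : ∀ i, lev₁ i ∣ M)
    (hinj₁ : Function.Injective lev₁) (h1 : ∀ i, 1 < lev₁ i)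
    (hΦ : ∀ i (σ : K i →+* ℂ), σ ∈ (Φ i).1 ↔ 2 * (expOf (lev₁ i) (K i) σ).val < lev₁ i)
    (hΦL : ∀ i (σ : L i →+* ℂ), σ ∈ (ΦL i).1 ↔ 2 * (expOf (2 * lev₁ i) (L i) σ).val < 2 * lev₁ i)
    (hA : ∀ i, IsCMTypeRealisation (Φ i) (A i) (ι i) (θ i)) (hA' : ∀ i, IsCMTypeRealisation (ΦL i) (A' i) (ι' i) (θ' i))
    (hΦ₄ : ∀ σ : K₄ →+* ℂ, σ ∈ Φ₄.1 ↔ 2 * (expOf 4 K₄ σ).val < 4) (hA₄ : IsCMTypeRealisation Φ₄ A₄ ι₄ θ₄)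
    (hΦ₁₂ : ∀ σ : K₁₂ →+* ℂ, σ ∈ Φ₁₂.1 ↔ 2 * (expOf 12 K₁₂ σ).val < 12) (hA₁₂ : IsCMTypeRealisation Φ₁₂ A₁₂ ι₁₂ θ₁₂)
    (hΦ₂₀ : ∀ σ : K₂₀ →+* ℂ, σ ∈ Φ₂₀.1 ↔ 2 * (expOf 20 K₂₀ σ).val < 20) (hA₂₀ : IsCMTypeRealisation Φ₂₀ A₂₀ ι₂₀ θ₂₀)
    (hΦ₆₀ : ∀ σ : K₆₀ →+* ℂ, σ ∈ Φ₆₀.1 ↔ 2 * (expOf 60 K₆₀ σ).val < 60) (hA₆₀ : IsCMTypeRealisation Φ₆₀ A₆₀ ι₆₀ θ₆₀)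
    (hΦ₂₄ : ∀ σ : K₂₄ →+* ℂ, σ ∈ Φ₂₄.1 ↔ 2 * (expOf 24 K₂₄ σ).val < 24) (hA₂₄ : IsCMTypeRealisation Φ₂₄ A₂₄ ι₂₄ θ₂₄)
    (h4 : ∀ j, 4 ∣ lev₂ j) (h8 : ∀ j, 8 ≤ lev₂ j) (h12 : ∀ j, lev₂ j ≠ 12) (h20 : ∀ j, lev₂ j ≠ 20) (h24 : ∀ j, lev₂ j ≠ 24)
    (h60 : ∀ j, lev₂ j ≠ 60) (hinj₂ : Function.Injective lev₂)
    (hΨ : ∀ j (σ : F j →+* ℂ), σ ∈ (Ψ j).1 ↔ 2 * (expOf (lev₂ j) (F j) σ).val < lev₂ j)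
    (hC : ∀ j, IsCMTypeRealisation (Ψ j) (C j) (ιC j) (θC j)) :
    Nonempty ((⨁ fun a : Fin 6 =>
        (![A₂₀, A₆₀, A₂₄, ⨁ fun l : Fin 2 => (![A₄, A₁₂] : Fin 2 → AbelianVariety ℂ) l,
           ⨁ fun i => ⨁ fun l : Fin 2 => (![A i, A' i] : Fin 2 → AbelianVariety ℂ) l, ⨁ C] : Fin 6 → AbelianVariety ℂ) a).endAlgebra ≃ₐ[ℚ]
      Matrix (Fin 4) (Fin 4) (IntermediateField.adjoin ℚ {zetaOf 20 K₂₀ + zetaOf 20 K₂₀ ^ 3 + zetaOf 20 K₂₀ ^ 7 + zetaOf 20 K₂₀ ^ 9}) ×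
        (Matrix (Fin 4) (Fin 4) (IntermediateField.adjoin ℚ {zetaOf 60 K₆₀ + zetaOf 60 K₆₀ ^ 11 + zetaOf 60 K₆₀ ^ 19 + zetaOf 60 K₆₀ ^ 29}) ×
          (Matrix (Fin 4) (Fin 4) (IntermediateField.adjoin ℚ {zetaOf 24 K₂₄ + zetaOf 24 K₂₄ ^ 5 + zetaOf 24 K₂₄ ^ 7 + zetaOf 24 K₂₄ ^ 11}) ×
            (Matrix (Fin 3) (Fin 3) K₄ × ((∀ i, Matrix (Fin 2) (Fin 2) (K i)) ×
              (∀ j, Matrix (Fin 2) (Fin 2) (IntermediateField.adjoin ℚ {zetaOf (lev₂ j) (F j) - (zetaOf (lev₂ j) (F j))⁻¹}))))))) := by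
  classical
  obtain ⟨E, -⟩ := AbelianVariety.nonempty_algEquiv_endAlgebra_biproduct_pi
    (A := fun a : Fin 6 => (![A₂₀, A₆₀, A₂₄, ⨁ fun l : Fin 2 => (![A₄, A₁₂] : Fin 2 → AbelianVariety ℂ) l,
      ⨁ fun i => ⨁ fun l : Fin 2 => (![A i, A' i] : Fin 2 → AbelianVariety ℂ) l, ⨁ C] : Fin 6 → AbelianVariety ℂ) a)
    (hom_eq_zero_blocks_hundredTwentyDvd hodd hdvd h1 hΦ hΦL hA hA' hA₄ hΦ₁₂ hA₁₂ hΦ₂₀ hA₂₀ hΦ₆₀ hA₆₀ hΦ₂₄ hA₂₄ h4 h8 h12 h20 h24 h60 hΨ hC)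
  obtain ⟨P⟩ := nonempty_pi_fin_six_algEquiv_prod₆₀
    (fun a : Fin 6 => ((![A₂₀, A₆₀, A₂₄, ⨁ fun l : Fin 2 => (![A₄, A₁₂] : Fin 2 → AbelianVariety ℂ) l,
      ⨁ fun i => ⨁ fun l : Fin 2 => (![A i, A' i] : Fin 2 → AbelianVariety ℂ) l, ⨁ C] : Fin 6 → AbelianVariety ℂ) a).endAlgebra)
  obtain ⟨-, -, -, ⟨e₂₀⟩, -⟩ := nonempty_matrix_four_algEquiv_endAlgebra_twenty Φ₂₀ hΦ₂₀ hA₂₀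
  obtain ⟨-, -, -, ⟨e₆₀⟩, -⟩ := nonempty_matrix_four_algEquiv_endAlgebra_sixty Φ₆₀ hΦ₆₀ hA₆₀
  obtain ⟨-, -, -, ⟨e₂₄⟩, -⟩ := nonempty_matrix_four_algEquiv_endAlgebra_twentyFour Φ₂₄ hΦ₂₄ hA₂₄
  obtain ⟨e₀⟩ := nonempty_endAlgebra_four_twelve_algEquiv_matrix hΦ₄ hA₄ hΦ₁₂ hA₁₂
  obtain ⟨e₁⟩ := nonempty_endAlgebra_algEquiv_pi_matrix_twiceOdd hodd hdvd hinj₁ h1 hΦ hΦL hA hA'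
  obtain ⟨e₂⟩ := nonempty_endAlgebra_biproduct_algEquiv_pi_fourDvd h4 h8 h20 h24 h60 hinj₂ hΨ hC
  exact ⟨(E.trans P).trans (AlgEquiv.prodCongr e₂₀.symm (AlgEquiv.prodCongr e₆₀.symm (AlgEquiv.prodCongr e₂₄.symm
    (AlgEquiv.prodCongr e₀ (AlgEquiv.prodCongr e₁ e₂)))))⟩

/-- **Dimension count at the levels `120 ∣ m`: `dim_ℚ End⁰(J) = 146 + 4 Σ_i φ(d_i) + 2 Σ_j φ(e_j)` and `2 dim J = 38 + 2 Σ_i φ(d_i) + Σ_j φ(e_j)`**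
(`m = 120`: `d = 3, 5, 15`, `e = 8, 40, 120`: `146 + 56 + 104 = 306`, `g = 59`).
[cite: GalleseGoodsonLombardo2024, §3 Thm. 3.0 («dim X_d = φ(d)/2») and §3.5 Lemma 14] [cite: MumfordAV1970, §19 Cor. 2 of Thm. 3] -/
theorem finrank_endAlgebra_hundredTwentyDvd [NeZero M] (hodd : Odd M) (hdvd : ∀ i, lev₁ i ∣ M) (hinj₁ : Function.Injective lev₁)
    (h1 : ∀ i, 1 < lev₁ i) (hΦ : ∀ i (σ : K i →+* ℂ), σ ∈ (Φ i).1 ↔ 2 * (expOf (lev₁ i) (K i) σ).val < lev₁ i)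
    (hΦL : ∀ i (σ : L i →+* ℂ), σ ∈ (ΦL i).1 ↔ 2 * (expOf (2 * lev₁ i) (L i) σ).val < 2 * lev₁ i)
    (hA : ∀ i, IsCMTypeRealisation (Φ i) (A i) (ι i) (θ i)) (hA' : ∀ i, IsCMTypeRealisation (ΦL i) (A' i) (ι' i) (θ' i))
    (hΦ₄ : ∀ σ : K₄ →+* ℂ, σ ∈ Φ₄.1 ↔ 2 * (expOf 4 K₄ σ).val < 4) (hA₄ : IsCMTypeRealisation Φ₄ A₄ ι₄ θ₄)
    (hΦ₁₂ : ∀ σ : K₁₂ →+* ℂ, σ ∈ Φ₁₂.1 ↔ 2 * (expOf 12 K₁₂ σ).val < 12) (hA₁₂ : IsCMTypeRealisation Φ₁₂ A₁₂ ι₁₂ θ₁₂)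
    (hΦ₂₀ : ∀ σ : K₂₀ →+* ℂ, σ ∈ Φ₂₀.1 ↔ 2 * (expOf 20 K₂₀ σ).val < 20) (hA₂₀ : IsCMTypeRealisation Φ₂₀ A₂₀ ι₂₀ θ₂₀)
    (hΦ₆₀ : ∀ σ : K₆₀ →+* ℂ, σ ∈ Φ₆₀.1 ↔ 2 * (expOf 60 K₆₀ σ).val < 60) (hA₆₀ : IsCMTypeRealisation Φ₆₀ A₆₀ ι₆₀ θ₆₀)
    (hΦ₂₄ : ∀ σ : K₂₄ →+* ℂ, σ ∈ Φ₂₄.1 ↔ 2 * (expOf 24 K₂₄ σ).val < 24) (hA₂₄ : IsCMTypeRealisation Φ₂₄ A₂₄ ι₂₄ θ₂₄)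
    (h4 : ∀ j, 4 ∣ lev₂ j) (h8 : ∀ j, 8 ≤ lev₂ j) (h12 : ∀ j, lev₂ j ≠ 12) (h20 : ∀ j, lev₂ j ≠ 20) (h24 : ∀ j, lev₂ j ≠ 24)
    (h60 : ∀ j, lev₂ j ≠ 60) (hinj₂ : Function.Injective lev₂)
    (hΨ : ∀ j (σ : F j →+* ℂ), σ ∈ (Ψ j).1 ↔ 2 * (expOf (lev₂ j) (F j) σ).val < lev₂ j)
    (hC : ∀ j, IsCMTypeRealisation (Ψ j) (C j) (ιC j) (θC j)) :
    finrank ℚ (⨁ fun a : Fin 6 =>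
        (![A₂₀, A₆₀, A₂₄, ⨁ fun l : Fin 2 => (![A₄, A₁₂] : Fin 2 → AbelianVariety ℂ) l,
           ⨁ fun i => ⨁ fun l : Fin 2 => (![A i, A' i] : Fin 2 → AbelianVariety ℂ) l, ⨁ C] : Fin 6 → AbelianVariety ℂ) a).endAlgebra =
      146 + 4 * ∑ i, Nat.totient (lev₁ i) + 2 * ∑ j, Nat.totient (lev₂ j) ∧
    2 * (⨁ fun a : Fin 6 =>
        (![A₂₀, A₆₀, A₂₄, ⨁ fun l : Fin 2 => (![A₄, A₁₂] : Fin 2 → AbelianVariety ℂ) l,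
           ⨁ fun i => ⨁ fun l : Fin 2 => (![A i, A' i] : Fin 2 → AbelianVariety ℂ) l, ⨁ C] : Fin 6 → AbelianVariety ℂ) a).dim =
      38 + 2 * ∑ i, Nat.totient (lev₁ i) + ∑ j, Nat.totient (lev₂ j) := by
  classical
  obtain ⟨hfr₄, hdim₄⟩ := finrank_endAlgebra_twentyFourDvd hodd hdvd hinj₁ h1 hΦ hΦL hA hA' hΦ₄ hA₄ hΦ₁₂ hA₁₂ hΦ₂₄ hA₂₄ h4 h8 h12 h20 h24
    h60 hinj₂ hΨ hC
  obtain ⟨hd₂₀, -, -, ⟨e₂₀⟩, -, hfr₂₀, -⟩ := nonempty_matrix_four_algEquiv_endAlgebra_twenty Φ₂₀ hΦ₂₀ hA₂₀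
  obtain ⟨hd₆₀, -, -, ⟨e₆₀⟩, -, hfr₆₀, -⟩ := nonempty_matrix_four_algEquiv_endAlgebra_sixty Φ₆₀ hΦ₆₀ hA₆₀
  refine ⟨?_, ?_⟩
  · obtain ⟨e⟩ := nonempty_endAlgebra_algEquiv_hundredTwentyDvd hodd hdvd hinj₁ h1 hΦ hΦL hA hA' hΦ₄ hA₄ hΦ₁₂ hA₁₂ hΦ₂₀ hA₂₀ hΦ₆₀ hA₆₀
      hΦ₂₄ hA₂₄ h4 h8 h12 h20 h24 h60 hinj₂ hΨ hC
    obtain ⟨e'⟩ := nonempty_endAlgebra_algEquiv_twentyFourDvd hodd hdvd hinj₁ h1 hΦ hΦL hA hA' hΦ₄ hA₄ hΦ₁₂ hA₁₂ hΦ₂₄ hA₂₄ h4 h8 h12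
      h20 h24 h60 hinj₂ hΨ hC
    haveI : ∀ j, FiniteDimensional ℚ (IntermediateField.adjoin ℚ {zetaOf (lev₂ j) (F j) - (zetaOf (lev₂ j) (F j))⁻¹}) := fun j =>
      IntermediateField.finiteDimensional_left _
    haveI : ∀ j, Module.Finite ℚ (Matrix (Fin 2) (Fin 2)
        (IntermediateField.adjoin ℚ {zetaOf (lev₂ j) (F j) - (zetaOf (lev₂ j) (F j))⁻¹})) := fun j => Module.Finite.matrix
    haveI : ∀ j, Module.Free ℚ (Matrix (Fin 2) (Fin 2)
        (IntermediateField.adjoin ℚ {zetaOf (lev₂ j) (F j) - (zetaOf (lev₂ j) (F j))⁻¹})) := fun j => inferInstance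
    haveI : ∀ i, Module.Finite ℚ (Matrix (Fin 2) (Fin 2) (K i)) := fun i => Module.Finite.matrix
    haveI : ∀ i, Module.Free ℚ (Matrix (Fin 2) (Fin 2) (K i)) := fun i => inferInstance
    haveI : Module.Finite ℚ (∀ j, Matrix (Fin 2) (Fin 2)
        (IntermediateField.adjoin ℚ {zetaOf (lev₂ j) (F j) - (zetaOf (lev₂ j) (F j))⁻¹})) := inferInstance
    haveI : Module.Free ℚ (∀ j, Matrix (Fin 2) (Fin 2)
        (IntermediateField.adjoin ℚ {zetaOf (lev₂ j) (F j) - (zetaOf (lev₂ j) (F j))⁻¹})) := inferInstance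
    haveI : Module.Finite ℚ (∀ i, Matrix (Fin 2) (Fin 2) (K i)) := inferInstance
    haveI : Module.Free ℚ (∀ i, Matrix (Fin 2) (Fin 2) (K i)) := inferInstance
    haveI : Module.Finite ℚ ((∀ i, Matrix (Fin 2) (Fin 2) (K i)) × (∀ j, Matrix (Fin 2) (Fin 2)
        (IntermediateField.adjoin ℚ {zetaOf (lev₂ j) (F j) - (zetaOf (lev₂ j) (F j))⁻¹}))) := inferInstance
    haveI : Module.Free ℚ ((∀ i, Matrix (Fin 2) (Fin 2) (K i)) × (∀ j, Matrix (Fin 2) (Fin 2)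
        (IntermediateField.adjoin ℚ {zetaOf (lev₂ j) (F j) - (zetaOf (lev₂ j) (F j))⁻¹}))) := inferInstance
    haveI : Module.Finite ℚ (Matrix (Fin 3) (Fin 3) K₄) := Module.Finite.matrix
    haveI : Module.Free ℚ (Matrix (Fin 3) (Fin 3) K₄) := inferInstance
    haveI : Module.Finite ℚ (Matrix (Fin 3) (Fin 3) K₄ × ((∀ i, Matrix (Fin 2) (Fin 2) (K i)) × (∀ j, Matrix (Fin 2) (Fin 2)
        (IntermediateField.adjoin ℚ {zetaOf (lev₂ j) (F j) - (zetaOf (lev₂ j) (F j))⁻¹})))) := inferInstance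
    haveI : Module.Free ℚ (Matrix (Fin 3) (Fin 3) K₄ × ((∀ i, Matrix (Fin 2) (Fin 2) (K i)) × (∀ j, Matrix (Fin 2) (Fin 2)
        (IntermediateField.adjoin ℚ {zetaOf (lev₂ j) (F j) - (zetaOf (lev₂ j) (F j))⁻¹})))) := inferInstance
    haveI : FiniteDimensional ℚ (IntermediateField.adjoin ℚ {zetaOf 24 K₂₄ + zetaOf 24 K₂₄ ^ 5 + zetaOf 24 K₂₄ ^ 7 + zetaOf 24 K₂₄ ^ 11}) :=
      IntermediateField.finiteDimensional_left _
    haveI : Module.Finite ℚ (Matrix (Fin 4) (Fin 4)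
        (IntermediateField.adjoin ℚ {zetaOf 24 K₂₄ + zetaOf 24 K₂₄ ^ 5 + zetaOf 24 K₂₄ ^ 7 + zetaOf 24 K₂₄ ^ 11})) := Module.Finite.matrix
    haveI : Module.Free ℚ (Matrix (Fin 4) (Fin 4)
        (IntermediateField.adjoin ℚ {zetaOf 24 K₂₄ + zetaOf 24 K₂₄ ^ 5 + zetaOf 24 K₂₄ ^ 7 + zetaOf 24 K₂₄ ^ 11})) := inferInstance
    haveI : Module.Finite ℚ (Matrix (Fin 4) (Fin 4)
        (IntermediateField.adjoin ℚ {zetaOf 24 K₂₄ + zetaOf 24 K₂₄ ^ 5 + zetaOf 24 K₂₄ ^ 7 + zetaOf 24 K₂₄ ^ 11}) ×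
        (Matrix (Fin 3) (Fin 3) K₄ × ((∀ i, Matrix (Fin 2) (Fin 2) (K i)) × (∀ j, Matrix (Fin 2) (Fin 2)
          (IntermediateField.adjoin ℚ {zetaOf (lev₂ j) (F j) - (zetaOf (lev₂ j) (F j))⁻¹}))))) := inferInstance
    haveI : Module.Free ℚ (Matrix (Fin 4) (Fin 4)
        (IntermediateField.adjoin ℚ {zetaOf 24 K₂₄ + zetaOf 24 K₂₄ ^ 5 + zetaOf 24 K₂₄ ^ 7 + zetaOf 24 K₂₄ ^ 11}) ×
        (Matrix (Fin 3) (Fin 3) K₄ × ((∀ i, Matrix (Fin 2) (Fin 2) (K i)) × (∀ j, Matrix (Fin 2) (Fin 2)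
          (IntermediateField.adjoin ℚ {zetaOf (lev₂ j) (F j) - (zetaOf (lev₂ j) (F j))⁻¹}))))) := inferInstance
    haveI : FiniteDimensional ℚ (IntermediateField.adjoin ℚ {zetaOf 60 K₆₀ + zetaOf 60 K₆₀ ^ 11 + zetaOf 60 K₆₀ ^ 19 + zetaOf 60 K₆₀ ^ 29}) :=
      IntermediateField.finiteDimensional_left _
    haveI : Module.Finite ℚ (Matrix (Fin 4) (Fin 4)
        (IntermediateField.adjoin ℚ {zetaOf 60 K₆₀ + zetaOf 60 K₆₀ ^ 11 + zetaOf 60 K₆₀ ^ 19 + zetaOf 60 K₆₀ ^ 29})) := Module.Finite.matrix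
    haveI : Module.Free ℚ (Matrix (Fin 4) (Fin 4)
        (IntermediateField.adjoin ℚ {zetaOf 60 K₆₀ + zetaOf 60 K₆₀ ^ 11 + zetaOf 60 K₆₀ ^ 19 + zetaOf 60 K₆₀ ^ 29})) := inferInstance
    haveI : Module.Finite ℚ (Matrix (Fin 4) (Fin 4)
        (IntermediateField.adjoin ℚ {zetaOf 60 K₆₀ + zetaOf 60 K₆₀ ^ 11 + zetaOf 60 K₆₀ ^ 19 + zetaOf 60 K₆₀ ^ 29}) ×
        (Matrix (Fin 4) (Fin 4) (IntermediateField.adjoin ℚ {zetaOf 24 K₂₄ + zetaOf 24 K₂₄ ^ 5 + zetaOf 24 K₂₄ ^ 7 + zetaOf 24 K₂₄ ^ 11}) ×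
          (Matrix (Fin 3) (Fin 3) K₄ × ((∀ i, Matrix (Fin 2) (Fin 2) (K i)) × (∀ j, Matrix (Fin 2) (Fin 2)
            (IntermediateField.adjoin ℚ {zetaOf (lev₂ j) (F j) - (zetaOf (lev₂ j) (F j))⁻¹})))))) := inferInstance
    haveI : Module.Free ℚ (Matrix (Fin 4) (Fin 4)
        (IntermediateField.adjoin ℚ {zetaOf 60 K₆₀ + zetaOf 60 K₆₀ ^ 11 + zetaOf 60 K₆₀ ^ 19 + zetaOf 60 K₆₀ ^ 29}) ×
        (Matrix (Fin 4) (Fin 4) (IntermediateField.adjoin ℚ {zetaOf 24 K₂₄ + zetaOf 24 K₂₄ ^ 5 + zetaOf 24 K₂₄ ^ 7 + zetaOf 24 K₂₄ ^ 11}) ×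
          (Matrix (Fin 3) (Fin 3) K₄ × ((∀ i, Matrix (Fin 2) (Fin 2) (K i)) × (∀ j, Matrix (Fin 2) (Fin 2)
            (IntermediateField.adjoin ℚ {zetaOf (lev₂ j) (F j) - (zetaOf (lev₂ j) (F j))⁻¹})))))) := inferInstance
    haveI : FiniteDimensional ℚ (IntermediateField.adjoin ℚ {zetaOf 20 K₂₀ + zetaOf 20 K₂₀ ^ 3 + zetaOf 20 K₂₀ ^ 7 + zetaOf 20 K₂₀ ^ 9}) :=
      IntermediateField.finiteDimensional_left _
    haveI : Module.Finite ℚ (Matrix (Fin 4) (Fin 4)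
        (IntermediateField.adjoin ℚ {zetaOf 20 K₂₀ + zetaOf 20 K₂₀ ^ 3 + zetaOf 20 K₂₀ ^ 7 + zetaOf 20 K₂₀ ^ 9})) := Module.Finite.matrix
    haveI : Module.Free ℚ (Matrix (Fin 4) (Fin 4)
        (IntermediateField.adjoin ℚ {zetaOf 20 K₂₀ + zetaOf 20 K₂₀ ^ 3 + zetaOf 20 K₂₀ ^ 7 + zetaOf 20 K₂₀ ^ 9})) := inferInstance
    have hrest : finrank ℚ (Matrix (Fin 4) (Fin 4)
        (IntermediateField.adjoin ℚ {zetaOf 24 K₂₄ + zetaOf 24 K₂₄ ^ 5 + zetaOf 24 K₂₄ ^ 7 + zetaOf 24 K₂₄ ^ 11}) ×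
        (Matrix (Fin 3) (Fin 3) K₄ × ((∀ i, Matrix (Fin 2) (Fin 2) (K i)) × (∀ j, Matrix (Fin 2) (Fin 2)
          (IntermediateField.adjoin ℚ {zetaOf (lev₂ j) (F j) - (zetaOf (lev₂ j) (F j))⁻¹}))))) =
        50 + 4 * ∑ i, Nat.totient (lev₁ i) + 2 * ∑ j, Nat.totient (lev₂ j) := by
      rw [← e'.toLinearEquiv.finrank_eq, hfr₄]
    have h20' : finrank ℚ (Matrix (Fin 4) (Fin 4)
        (IntermediateField.adjoin ℚ {zetaOf 20 K₂₀ + zetaOf 20 K₂₀ ^ 3 + zetaOf 20 K₂₀ ^ 7 + zetaOf 20 K₂₀ ^ 9})) = 32 := by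
      rw [e₂₀.toLinearEquiv.finrank_eq, hfr₂₀]
    have h60' : finrank ℚ (Matrix (Fin 4) (Fin 4)
        (IntermediateField.adjoin ℚ {zetaOf 60 K₆₀ + zetaOf 60 K₆₀ ^ 11 + zetaOf 60 K₆₀ ^ 19 + zetaOf 60 K₆₀ ^ 29})) = 64 := by
      rw [e₆₀.toLinearEquiv.finrank_eq, hfr₆₀]
    rw [e.toLinearEquiv.finrank_eq, Module.finrank_prod, Module.finrank_prod, h20', h60', hrest]
    omega
  · have h4' : 2 * (⨁ fun a : Fin 4 => (![A₂₄, ⨁ fun l : Fin 2 => (![A₄, A₁₂] : Fin 2 → AbelianVariety ℂ) l,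
        ⨁ fun i => ⨁ fun l : Fin 2 => (![A i, A' i] : Fin 2 → AbelianVariety ℂ) l, ⨁ C] : Fin 4 → AbelianVariety ℂ) a).dim =
        2 * (A₂₄.dim + (⨁ fun l : Fin 2 => (![A₄, A₁₂] : Fin 2 → AbelianVariety ℂ) l).dim +
          (⨁ fun i => ⨁ fun l : Fin 2 => (![A i, A' i] : Fin 2 → AbelianVariety ℂ) l).dim + (⨁ C).dim) := by
      rw [AbelianVariety.dim_biproduct, Fin.sum_univ_four]
      rfl
    rw [AbelianVariety.dim_biproduct, Fin.sum_univ_six]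
    show 2 * (A₂₀.dim + A₆₀.dim + A₂₄.dim + (⨁ fun l : Fin 2 => (![A₄, A₁₂] : Fin 2 → AbelianVariety ℂ) l).dim +
        (⨁ fun i => ⨁ fun l : Fin 2 => (![A i, A' i] : Fin 2 → AbelianVariety ℂ) l).dim + (⨁ C).dim) =
      38 + 2 * ∑ i, Nat.totient (lev₁ i) + ∑ j, Nat.totient (lev₂ j)
    rw [hd₂₀, hd₆₀]
    omega

end SixtyDvd

end HyperellipticJacobian

end Literature.AlgebraicGeometry.ComplexMultiplication

end
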